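import Summits.AtomisticToContinuum.BoseEinsteinCondensation.Theses.BECConjugateDomination
import Literature.MathematicalPhysics.QuantumManyBody.BoseGasCatStates
import Literature.MathematicalPhysics.QuantumManyBody.BoseGasFreeDirichletBEC
import Summits.AtomisticToContinuum.BoseEinsteinCondensation.Theorems.HardCoreExtension.Negative.ScalingReductions
import Literature.MathematicalPhysics.QuantumManyBody.HardCoreScatteringLength
import Summits.AtomisticToContinuum.BoseEinsteinCondensation.Theorems.PuffFloor.Negative.PuffFloorFalseForNearMinimisers
import Literature.MathematicalPhysics.QuantumManyBody.LiebYngvasonPoincare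
import Literature.MathematicalPhysics.QuantumManyBody.LiebYngvasonLowerBound
import Summits.AtomisticToContinuum.BoseEinsteinCondensation.Theorems.HardCoreExtension.Negative.QuadraticFloorNearMinFalse
import Summits.AtomisticToContinuum.BoseEinsteinCondensation.Theorems.PuffFloor.Negative.FreeGasModel

/-!
# Disproof of `HardCoreExtension` (stmt-AtomisticToContinuum-11786) — standing adversary, gen 4

Crux (route `BECConjugateDomination`, rank 5; verbatim the statement of retired stmt-6737):
`HardCoreExtension := SmoothClassBEC → BoseEinsteinCondensation`, where the antecedent
`SmoothClassBEC` (`A`, named below) is ground-state BEC at all small densities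
(`∃ ρ₀ > 0 ∀ ρ ∈ (0,ρ₀), HasGroundStateBEC v ρ`) for every potential of the SMOOTH CLASS — repulsive
finite range (`IsRepulsiveFiniteRange`), finite (`∀ r, v r ≠ ⊤`), `C²` as `ṽ(x) = v(|x|)` on `ℝ³`,
edge condition `‖D²ṽ‖ ≤ Cₑ√ṽ` — and the consequent `B` is the audited conjunct (the same for EVERY
repulsive finite-range `v`: hard cores, shells, steps, kinks included).

VERDICT (gen 4, 2026-08-16): RESISTS. `¬crux ↔ A ∧ ¬B` (§1): a kill needs a PROOF of thermodynamic-limit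
BEC for smooth repulsive potentials (open) AND a refutation of the conjunct (no junk in four generations
of hunts, §5/§9/§11). What the adversary CAN do is typed below: refute/classify every transfer principle that
would prove the crux cheaply (§3–§4, §6), and break the over-general first lemmas of the lines (§7–§8, §10).

## Findings (index)

* §1 LOGIC. `crux_iff` (`A → B`, `Iff.rfl`), `crux_of_conjunct` (`B →` crux: the crux is formally
  WEAKER than the conjunct), `not_crux_iff : ¬crux ↔ A ∧ ¬B` — ANY DISPROOF MUST PROVE DILUTE BEC
  FOR EVERY SMOOTH-CLASS POTENTIAL (thermodynamic-limit BEC for genuinely interacting soft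
  potentials: open, LSSY2005 Ch. 5) AND refute the conjunct. `crux_iff_nonsmooth`: given `A`, only
  the NON-smooth members of the conjunct's class are load-bearing. `antecedentAt_zero`: the free gas
  is in the smooth class (all four clauses) and HAS dilute BEC (tree: `hasGroundStateBEC_zero`) — no
  ex-falso exit through `¬A` at `v = 0`.
* §2 CLASS SEPARATION. `hardCorePotential_admissible_not_smooth`: `⊤·1_{r<a}` is in `B`'s class and
  violates `A`'s finiteness clause — the crux genuinely has to manufacture BEC for hard cores.
  §2b `smoothClass_smul`: the smooth class is a cone; §6 `smoothClass_scalePotential`: and dilation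
  invariant.
* §3 HIGH-DENSITY OBSTRUCTION (gen 1; importable copy LANDED p73104 as
  `Theorems/HardCoreExtension/Negative/HighDensityObstruction.lean`). Packed boxes: `E₀^D(N,L) = ⊤ ⇒
  condensateNumber v N L = 0` (`N ≥ 2`); hard spheres above `8/a³`: NO ground-state BEC
  (`not_hasGroundStateBEC_hardCorePotential`); in `A`'s class nothing happens at any density
  (`criticalDensity_eq_top_of_finite_contDiff`, `groundStateEnergy_lt_top_of_finite_contDiff`).
* §4 REFUTED / CLASSIFIED TRANSFER PRINCIPLES (gen 1). `not_hasGroundStateBEC_mono_potential`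
  ("`v ≤ w`, BEC(`v`,ρ) ⇒ BEC(`w`,ρ)" FALSE), `not_condensateNumber_mono_potential` (FALSE in one box),
  `not_hasGroundStateBEC_allDensities` (all-density `B` FALSE), `monotoneDiluteTransfer_iff_conjunct`
  (the dilute remnant IS `B`), `crux_of_smoothMinorantTransfer` / `smoothMinorantTransfer_of_conjunct`.
  §4b what IS true: `windowInf_le_condensateNumber_of_le` (window transfer) and why it is gap-limited
  (`freeWindowInf_le`).
* §5 census gen 1 (prose).
* §6 (gen 2) DILATION COVARIANCE AND QUANTIFIER ORDER — LANDED as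
  `Theorems/HardCoreExtension/Negative/ScalingReductions.lean` (imported): `HasGroundStateBEC (s⁻²v(·/s))
  (ρ/s³) ↔ HasGroundStateBEC v ρ`; both classes dilation invariant; hence the `∃ρ₀ ∀v` CONJUNCT IS FALSE
  (`not_uniformRho_conjunct`), the `∃ρ₀ ∀v` antecedent is the ALL-DENSITY smooth BEC
  (`uniformRhoAntecedent_iff_allDensities` — no admissible repair), and antecedent / conjunct / crux are
  their unit-range cases (`crux_iff_unitRange`: range is a gauge), absolute bounds on `𝔞` and range are
  free (`antecedent_iff_boundedScales`), and the refuters' `(a,R)`-uniform repair is its `R = 1` slice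
  (`Negative.uniformSmoothBEC_iff_unitRange`, landed p74992 in `Negative/UniformRepairNormalForm.lean`,
  with `Negative.finiteEnergyAtLowDensity`).
* §7 (gen 2) FIXED-BOX DEGENERACY JUNK in "∀ measurable `v` at fixed `(N,L)`" levers: the round-1 first
  lemma `Ideator3.MonotoneLimitTransfer` is FALSE as typed (hard shell `⊤·1_{[a,b*]}` tuned to the in/out
  degeneracy at `N = 2`; rank-one compression of `n₀` on zero-momentum two-body states gives a ground
  vector with `condensateOccupation = 0`); typed repair `Levers.MonotoneLimitTransferSimple`; paper proof
  in the docstring of the sorried `not_monotoneLimitTransfer` (the ONLY `sorry` in this file), numbers by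
  kit job j009705.
* §8 (gen 2) STATUS OF ALL ROUND-1 LEVERS (true-now / true-on-paper / false-as-typed / conjectural /
  crux-strength), with `finiteEnergyAtLowDensity` PROVED (ideator 2's support hypothesis).
* §9 census gen 2 + open targets.
* §10 (gen 3) NEAR-MINIMISER UV JUNK — LANDED as
  `Theorems/HardCoreExtension/Negative/QuadraticFloorNearMinFalse.lean` (p76160, ACCEPTED f9ce93a9ecfe; imported):
  the class-blind lever `Ideator3.QuadraticFloor` (card `second-moment-floor-class-blind`, merged with
  `third-law-current-floor` by the triage panel) is FALSE AS TYPED (`not_quadraticFloorNearMin`, sorry-free,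
  free gas + the `PuffFloor` disprover's anti-correlated witness at a high mode): NO structure-factor floor
  `f(kn m) ≤ S m` over ALL modes can hold for near-minimisers when `(1 − f(k))·k → 0`. With the trichotomy
  EXACT minimisers (vacuous on hard cores: no `C¹` minimiser, unique continuation) / NEAR-minimisers
  (UV-false) / CAPPED near-minimiser floor `min(½, ·)` (consistent; typed repair
  `Levers.QuadraticFloorCapped`), this corrects the §8 verdict on `QuadraticFloor` ("crux-strength" →
  "false as typed; capped form crux-strength").
* §10c (gen 3) CHECKED VACUITY at hard cores: `not_finiteEnergy_and_pos_hardCore` — "finite periodic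
  energy ∧ pointwise non-zero" is unsatisfiable for `v = hardCorePotential a`, `N ≥ 2` (proposed p78090 as
  `Negative/HardCorePositivityVacuity.lean`); `puffFloorShape_vacuous_at_hardCore`.
* §10d (gen 3) CHECKED: finite-energy `C¹` hard-core states have `Ψ = DΨ = 0` at every contact
  configuration of the open box (`hardCore_contact_cauchyData`; p78297, ACCEPTED a409cfc20b30, as
  `Negative/HardCoreContactCauchyData.lean`) — zero Dirichlet AND Neumann data at the wall, the root of
  "no exact `C¹` minimiser" (unique continuation, paper).
* §11 census gen 3.
* §12 (gen 3) the PICKED line `third-law-current-floor` (S1–S7) read against this file: adversary concurs with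
  drefute (0 stub-false); which landed negatives forbid which weakenings; S7's feared `C¹`-infimum/form-bottom gap
  is absent for radial pair profiles (ACL cut-off argument).
* §13 (gen 4) THE COMMON GEOMETRIC SUB-CRUX OF BOTH SURVIVING LINES. The fixed-volume "variational
  simplicity" stubs — S5 `stub_diluteClustering` of the picked line and F `stub_slackUniformisation` of the
  registered skeleton `near-minimiser-slack-transfer` (T/F/A) — read at `v = hardCorePotential b` contain the
  CONNECTIVITY (mod `S_N`) OF THE DILUTE HARD-SPHERE CONFIGURATION SPACE ON `𝕋³_{L_N}` FOR ALL LARGE `N`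
  (`LemmaGConnected`, typed): an explicitly OPEN problem (Baryshnikov–Bubenik–Kahle, IMRN 2014, §6: "are there
  any bounding regions so that Conf(n,r) is connected for r ≤ C n^{-1/d}?"; ASSUMED as standing hypothesis
  (2.1.1) in Simányi's proof of the Boltzmann–Sinai ergodic hypothesis, AHP 2004). S5 as typed is FALSE under an
  exact tie between two non-permutation-related components (F and the crux's target survive symmetric ties
  WHENEVER the one-sphere `n₀` cross terms between the tied components vanish); confined ("caged") components can
  never tie (energy margin, priced on paper in §13), so only a purely topological splitting of the UNCONFINED region
  is at stake. CHECKED: S5 holds at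
  the free gas (`diluteClustering_holds_at_freeGas`: Poincaré gap, clustering modulo phase with `δ = π²t²/L²`,
  `t = min(1, η/33)`); S5's density guard is load-bearing (`finiteness_false_without_dilute_guard`); junk
  read-back of T/F/A (all pass) in the §13 docblock.

Prose only in docstrings; every `theorem` but `not_monotoneLimitTransfer` is sorry-free (`lean check` rc 0).
-/

noncomputable section

namespace Summit.AtomisticToContinuum.BoseEinsteinCondensation.Cruxes.HardCoreExtension.Disproof

open Literature.MathematicalPhysics.QuantumManyBody.BoseGas
open _root_.MeasureTheory _root_.Filter _root_.Metric
open scoped ENNReal Topology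

open Summit.AtomisticToContinuum.BoseEinsteinCondensation.Theses
open Summit.AtomisticToContinuum.BoseEinsteinCondensation.Theorems.HardCoreExtension

/-! ## §1 Logic of the crux -/

/-- The four curried hypotheses of the antecedent on the potential, bundled: the SMOOTH CLASS of the
route (verbatim `FisherGaussianDensityMode.InSmoothClass` of `Theorems/BECConjugateDominationDefs`,
restated here only because that module was unbuilt on the farm at writing time). [folklore] -/
def SmoothClass (v : ℝ → ℝ≥0∞) : Prop :=
  IsRepulsiveFiniteRange v ∧ (∀ r, v r ≠ ⊤) ∧ ContDiff ℝ 2 (fun x : Space => (v ‖x‖).toReal) ∧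
    ∃ Cₑ : ℝ, ∀ x : Space,
      ‖iteratedFDeriv ℝ 2 (fun x : Space => (v ‖x‖).toReal) x‖ ≤ Cₑ * Real.sqrt ((v ‖x‖).toReal)

/-- Dilute ground-state BEC for one potential: the common conclusion shape of `A` and `B`. [folklore] -/
def DiluteBEC (v : ℝ → ℝ≥0∞) : Prop :=
  ∃ ρ₀ : ℝ, 0 < ρ₀ ∧ ∀ ρ : ℝ, 0 < ρ → ρ < ρ₀ → HasGroundStateBEC v ρ

/-- The antecedent `A` of the crux, verbatim (curried). [folklore] -/
def SmoothClassBEC : Prop :=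
  ∀ v : ℝ → ℝ≥0∞, IsRepulsiveFiniteRange v → (∀ r, v r ≠ ⊤) →
    ContDiff ℝ 2 (fun x : Space => (v ‖x‖).toReal) →
    (∃ Cₑ : ℝ, ∀ x : Space, ‖iteratedFDeriv ℝ 2 (fun x : Space => (v ‖x‖).toReal) x‖ ≤
        Cₑ * Real.sqrt ((v ‖x‖).toReal)) →
    ∃ ρ₀ : ℝ, 0 < ρ₀ ∧ ∀ ρ : ℝ, 0 < ρ → ρ < ρ₀ → HasGroundStateBEC v ρ

/-- `A` in bundled form: dilute BEC on the smooth class. [folklore] -/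
theorem smoothClassBEC_iff : SmoothClassBEC ↔ ∀ v, SmoothClass v → DiluteBEC v :=
  ⟨fun h v ⟨h₁, h₂, h₃, h₄⟩ => h v h₁ h₂ h₃ h₄, fun h v h₁ h₂ h₃ h₄ => h v ⟨h₁, h₂, h₃, h₄⟩⟩

/-- The conjunct in the same vocabulary. [folklore] -/
theorem conjunct_iff :
    Literature.MathematicalPhysics.QuantumManyBody.BoseGas.BoseEinsteinCondensation ↔
      ∀ v, IsRepulsiveFiniteRange v → DiluteBEC v :=
  Iff.rfl

/-- The crux is literally `A → B`. [folklore] -/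
theorem crux_iff :
    BECConjugateDomination.HardCoreExtension ↔
      (SmoothClassBEC → Literature.MathematicalPhysics.QuantumManyBody.BoseGas.BoseEinsteinCondensation) :=
  Iff.rfl

/-- The crux is implied by the conjunct itself (so it is formally weaker than the conjunct, and
refuting it would refute the conjunct). [folklore] -/
theorem crux_of_conjunct
    (h : Literature.MathematicalPhysics.QuantumManyBody.BoseGas.BoseEinsteinCondensation) :
    BECConjugateDomination.HardCoreExtension :=
  fun _ => h

/-- The crux also follows ex falso from a refutation of the antecedent (dilute BEC failing for ONE
smooth-class `v`). No such `v` is known; `v = 0` is not one (`antecedentAt_zero`). [folklore] -/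
theorem crux_of_not_antecedent (h : ¬ SmoothClassBEC) : BECConjugateDomination.HardCoreExtension :=
  fun hA => absurd hA h

/-- **Negation normal form**: a disproof of the crux is exactly a proof of dilute BEC for every
smooth-class potential together with a refutation of the conjunct. [folklore] -/
theorem not_crux_iff :
    ¬ BECConjugateDomination.HardCoreExtension ↔
      (SmoothClassBEC ∧ ¬ Literature.MathematicalPhysics.QuantumManyBody.BoseGas.BoseEinsteinCondensation) := by
  rw [crux_iff]; tauto

/-- In particular any disproof proves the antecedent (thermodynamic-limit BEC for every smooth,
genuinely interacting dilute Bose gas — the open problem). [folklore] -/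
theorem antecedent_of_not_crux (h : ¬ BECConjugateDomination.HardCoreExtension) : SmoothClassBEC :=
  (not_crux_iff.1 h).1

/-- … and refutes the summit conjunct. [folklore] -/
theorem not_conjunct_of_not_crux (h : ¬ BECConjugateDomination.HardCoreExtension) :
    ¬ Literature.MathematicalPhysics.QuantumManyBody.BoseGas.BoseEinsteinCondensation :=
  (not_crux_iff.1 h).2

/-- Given the antecedent, the crux IS the conjunct; given a refutation of the conjunct, the crux IS
`¬A`. [folklore] -/
theorem crux_iff_of_antecedent (hA : SmoothClassBEC) :
    BECConjugateDomination.HardCoreExtension ↔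
      Literature.MathematicalPhysics.QuantumManyBody.BoseGas.BoseEinsteinCondensation :=
  ⟨fun h => h hA, fun h _ => h⟩

theorem crux_iff_of_not_conjunct
    (hB : ¬ Literature.MathematicalPhysics.QuantumManyBody.BoseGas.BoseEinsteinCondensation) :
    BECConjugateDomination.HardCoreExtension ↔ ¬ SmoothClassBEC :=
  ⟨fun h hA => hB (h hA), fun h hA => absurd hA h⟩

/-- **Only the non-smooth potentials are load-bearing**: the crux is equivalent to "`A` ⇒ dilute
BEC for every admissible `v` OUTSIDE the smooth class" (inside, `A` discharges `B` itself).
[folklore] -/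
theorem crux_iff_nonsmooth :
    BECConjugateDomination.HardCoreExtension ↔
      (SmoothClassBEC → ∀ v, IsRepulsiveFiniteRange v → ¬ SmoothClass v → DiluteBEC v) := by
  rw [crux_iff]
  constructor
  · exact fun h hA v hv _ => h hA v hv
  · intro h hA v hv
    by_cases hs : SmoothClass v
    · exact smoothClassBEC_iff.1 hA v hs
    · exact h hA v hv hs

/-- The free gas is in the smooth class (edge condition with `Cₑ = 0`): `A` is not vacuous. [folklore] -/
theorem smoothClass_zero : SmoothClass 0 := by
  refine ⟨⟨measurable_const, 0, fun _ _ => rfl⟩, fun _ => ENNReal.zero_ne_top, ?_, 0, fun x => ?_⟩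
  · simpa using contDiff_const (c := (0 : ℝ))
  · simp

/-- … and `A` HOLDS at the free gas (tree: `hasGroundStateBEC_zero`, Neumann bracketing into
macroscopic sub-cells): the `v = 0` instance is no ex-falso exit. [folklore] -/
theorem antecedentAt_zero : SmoothClass 0 ∧ DiluteBEC 0 :=
  ⟨smoothClass_zero, boseEinsteinCondensation_at_zero⟩

/-! ## §2 Class separation: what the crux must cover -/

/-- The hard-sphere gas `⊤·1_{r<a}` is in the conjunct's class and outside the smooth class (it is
not finite). [folklore] -/
theorem hardCorePotential_admissible_not_smooth {a : ℝ} (ha : 0 < a) :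
    IsRepulsiveFiniteRange (hardCorePotential a) ∧ ¬ SmoothClass (hardCorePotential a) :=
  ⟨isRepulsiveFiniteRange_hardCorePotential a, fun h => h.2.1 0 (hardCorePotential_of_lt ha)⟩

/-! ## §3 The high-density obstruction (hard cores) vs. none (smooth class) -/

/-- If `E₀^D(N, L) = ⊤` then every trial state bounds the condensate number by its own `λ_max`.
[folklore] -/
theorem condensateNumber_le_maxOccupation_of_groundStateEnergy_eq_top {v : ℝ → ℝ≥0∞} {N : ℕ}
    {L : ℝ} (hE : groundStateEnergy v N L = ⊤) (Ψ : TrialState N L) :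
    condensateNumber v N L ≤ maxOccupation N Ψ.ψ := by
  refine iSup₂_le fun δ _ => ?_
  exact iInf₂_le Ψ (by rw [hE, top_add]; exact le_top)

/-- **Packed boxes carry no condensate**: `E₀^D(N, L) = ⊤`, `N ≥ 2`, `L > 0` ⇒
`condensateNumber v N L = 0` (cat states, `λ_max ≤ N/m³` for every `m`). [folklore] -/
theorem condensateNumber_eq_zero_of_groundStateEnergy_eq_top {v : ℝ → ℝ≥0∞} {N : ℕ} {L : ℝ}
    (hE : groundStateEnergy v N L = ⊤) (hN : 2 ≤ N) (hL : 0 < L) :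
    condensateNumber v N L = 0 := by
  refine le_antisymm ?_ bot_le
  have h3 : Tendsto (fun m : ℕ => ((m : ℝ)) ^ 3) atTop atTop :=
    (tendsto_pow_atTop three_ne_zero).comp tendsto_natCast_atTop_atTop
  have hlim : Tendsto (fun m : ℕ => ENNReal.ofReal ((N : ℝ) / (m : ℝ) ^ 3)) atTop (𝓝 0) := by
    rw [← ENNReal.ofReal_zero]
    exact ENNReal.tendsto_ofReal (tendsto_const_nhds.div_atTop h3)
  refine ge_of_tendsto hlim ?_
  filter_upwards [eventually_gt_atTop 0] with m hm
  obtain ⟨Ψ, -, hocc⟩ := exists_fragmented_trialState hm hN hL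
  exact (condensateNumber_le_maxOccupation_of_groundStateEnergy_eq_top hE Ψ).trans hocc

/-- Hard spheres in a packed box (`⌈2L/a⌉³ < N`): `condensateNumber = 0`. [folklore] -/
theorem condensateNumber_hardCorePotential_eq_zero {a L : ℝ} (ha : 0 < a) {N : ℕ}
    (hpack : ⌈2 * L / a⌉₊ ^ 3 < N) (hN : 2 ≤ N) (hL : 0 < L) :
    condensateNumber (hardCorePotential a) N L = 0 :=
  condensateNumber_eq_zero_of_groundStateEnergy_eq_top
    (groundStateEnergy_hardCorePotential_eq_top ha hpack) hN hL

/-- **No ground-state BEC (typed sense) for hard spheres above `8/a³`.** [folklore] -/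
theorem not_hasGroundStateBEC_hardCorePotential {a : ℝ} (ha : 0 < a) {ρ : ℝ} (hρ : 8 / a ^ 3 < ρ) :
    ¬ HasGroundStateBEC (hardCorePotential a) ρ := by
  rintro ⟨c, hc, hev⟩
  have hρ0 : 0 < ρ := lt_trans (by positivity) hρ
  obtain ⟨N, hpack, hN2, hbec⟩ :=
    ((eventually_ceil_sideLength_pow_lt ha hρ).and ((eventually_ge_atTop 2).and hev)).exists
  have hL : 0 < sideLength ρ N := sideLength_pos_of_pos hρ0 (by omega)
  have h0 := condensateNumber_hardCorePotential_eq_zero ha hpack hN2 hL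
  rw [h0, nonpos_iff_eq_zero, ENNReal.ofReal_eq_zero] at hbec
  have hN' : (0 : ℝ) < N := by exact_mod_cast (show 0 < N by omega)
  nlinarith

/-- A finite, finite-range profile continuous as `x ↦ v(|x|)` on `ℝ³` has `∫ v(|x|) dx < ∞`. [folklore] -/
theorem lintegral_ne_top_of_finite_continuous {v : ℝ → ℝ≥0∞} (hv : IsRepulsiveFiniteRange v)
    (hfin : ∀ r, v r ≠ ⊤) (hcont : Continuous fun x : Space => (v ‖x‖).toReal) :
    (∫⁻ x : Space, v ‖x‖) ≠ ⊤ := by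
  obtain ⟨R₀, hR₀⟩ := hv.2
  have hsupp : Function.support (fun x : Space => v ‖x‖) ⊆ closedBall (0 : Space) (max R₀ 0) := by
    intro x hx
    rw [mem_closedBall, dist_zero_right]
    by_contra hlt
    exact hx (hR₀ _ ((le_max_left _ _).trans_lt (not_le.1 hlt)))
  have hfs : HasCompactSupport fun x : Space => (v ‖x‖).toReal := by
    refine HasCompactSupport.intro (isCompact_closedBall (0 : Space) (max R₀ 0)) fun x hx => ?_
    have h0 : v ‖x‖ = 0 := Function.notMem_support.1 fun h => hx (hsupp h)
    simp [h0]
  obtain ⟨C, hC⟩ := hcont.bounded_above_of_compact_support hfs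
  have hpt : ∀ x : Space, v ‖x‖ ≤ ENNReal.ofReal C := fun x => by
    rw [← ENNReal.ofReal_toReal (hfin ‖x‖)]
    exact ENNReal.ofReal_le_ofReal ((le_abs_self _).trans ((Real.norm_eq_abs _).symm.trans_le (hC x)))
  rw [← setLIntegral_eq_of_support_subset hsupp]
  refine ne_top_of_le_ne_top ?_ (setLIntegral_mono measurable_const fun x _ => hpt x)
  rw [setLIntegral_const]
  exact ENNReal.mul_ne_top ENNReal.ofReal_ne_top measure_closedBall_lt_top.ne

/-- **No critical density in the antecedent's class** (first three clauses suffice): `ρ_c(v) = ∞`.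
Contrast: `criticalDensity (hardCorePotential a) ≤ 8/a³` (tree). [folklore] -/
theorem criticalDensity_eq_top_of_finite_contDiff {v : ℝ → ℝ≥0∞} (hv : IsRepulsiveFiniteRange v)
    (hfin : ∀ r, v r ≠ ⊤) (hC : ContDiff ℝ 2 fun x : Space => (v ‖x‖).toReal) :
    criticalDensity v = ⊤ :=
  criticalDensity_eq_top_of_lintegral_ne_top hv
    (lintegral_ne_top_of_finite_continuous hv hfin hC.continuous)

/-- **No packed boxes in the antecedent's class**: `E₀^D(N, L) < ∞` for all `N ≥ 1`, `L > 0`.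
[folklore] -/
theorem groundStateEnergy_lt_top_of_finite_contDiff {v : ℝ → ℝ≥0∞} (hv : IsRepulsiveFiniteRange v)
    (hfin : ∀ r, v r ≠ ⊤) (hC : ContDiff ℝ 2 fun x : Space => (v ‖x‖).toReal) {N : ℕ} (hN : 0 < N)
    {L : ℝ} (hL : 0 < L) : groundStateEnergy v N L < ⊤ :=
  groundStateEnergy_lt_top_of_lintegral_ne_top' hv.1
    (lintegral_ne_top_of_finite_continuous hv hfin hC.continuous) hL hN

/-- The same for the bundled smooth class. [folklore] -/
theorem criticalDensity_eq_top_of_smoothClass {v : ℝ → ℝ≥0∞} (hv : SmoothClass v) :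
    criticalDensity v = ⊤ :=
  criticalDensity_eq_top_of_finite_contDiff hv.1 hv.2.1 hv.2.2.1

/-! ## §4 Transfer principles: refuted, or classified as the conjunct -/

/-- **BEC at ALL densities is false for the conjunct's class** (`a = 1`, `ρ = 9`). [folklore] -/
theorem not_hasGroundStateBEC_allDensities :
    ¬ ∀ v : ℝ → ℝ≥0∞, IsRepulsiveFiniteRange v → ∀ ρ : ℝ, 0 < ρ → HasGroundStateBEC v ρ := fun h =>
  not_hasGroundStateBEC_hardCorePotential one_pos (by norm_num : (8 : ℝ) / 1 ^ 3 < 9)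
    (h _ (isRepulsiveFiniteRange_hardCorePotential 1) 9 (by norm_num))

/-- **The monotone transfer of BEC along `v ≤ w` is false** at fixed density (`0 ≤` hard core of
radius `1`, `ρ = 9`): the comparison principle that would give the crux from the free gas. [folklore] -/
theorem not_hasGroundStateBEC_mono_potential :
    ¬ ∀ v w : ℝ → ℝ≥0∞, IsRepulsiveFiniteRange v → IsRepulsiveFiniteRange w → (∀ r, v r ≤ w r) →
        ∀ ρ : ℝ, 0 < ρ → HasGroundStateBEC v ρ → HasGroundStateBEC w ρ := fun h =>
  not_hasGroundStateBEC_hardCorePotential one_pos (by norm_num : (8 : ℝ) / 1 ^ 3 < 9)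
    (h 0 (hardCorePotential 1) ⟨measurable_const, 0, fun _ _ => rfl⟩
      (isRepulsiveFiniteRange_hardCorePotential 1) (fun _ => by simp) 9 (by norm_num)
      (hasGroundStateBEC_zero (by norm_num)))

/-- **`condensateNumber` is not monotone in the potential in a fixed box** (`N = 9`, `L = 1`,
`v = 0`, `w =` hard core of radius `1`). [folklore] -/
theorem not_condensateNumber_mono_potential :
    ¬ ∀ (v w : ℝ → ℝ≥0∞) (N : ℕ) (L : ℝ), (∀ r, v r ≤ w r) →
        condensateNumber v N L ≤ condensateNumber w N L := by
  intro h
  obtain ⟨c, hc, hfree⟩ := exists_condensateNumber_zero_ge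
  have hceil : ⌈2 * (1 : ℝ) / 1⌉₊ = 2 := by norm_num
  have hpack : ⌈2 * (1 : ℝ) / 1⌉₊ ^ 3 < 8 + 1 := by rw [hceil]; norm_num
  have h0 := condensateNumber_hardCorePotential_eq_zero one_pos hpack (by norm_num) one_pos
  have hle := (hfree 8 1 one_pos).trans
    ((h 0 (hardCorePotential 1) (8 + 1) 1 fun _ => by simp).trans h0.le)
  rw [nonpos_iff_eq_zero, ENNReal.ofReal_eq_zero] at hle
  push_cast at hle
  nlinarith

/-- The dilute monotone transfer principle (a statement): along admissible `v ≤ w`, dilute BEC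
passes from `v` to `w`. [folklore] -/
def MonotoneDiluteTransfer : Prop :=
  ∀ v w : ℝ → ℝ≥0∞, IsRepulsiveFiniteRange v → IsRepulsiveFiniteRange w → (∀ r, v r ≤ w r) →
    DiluteBEC v → DiluteBEC w

/-- **The dilute monotone transfer is equivalent to the conjunct** (apply it to `0 ≤ w`). [folklore] -/
theorem monotoneDiluteTransfer_iff_conjunct :
    MonotoneDiluteTransfer ↔
      Literature.MathematicalPhysics.QuantumManyBody.BoseGas.BoseEinsteinCondensation :=
  ⟨fun h w hw => h 0 w ⟨measurable_const, 0, fun _ _ => rfl⟩ hw (fun _ => by simp)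
      boseEinsteinCondensation_at_zero,
    fun h _ w _ hw _ _ => h w hw⟩

/-- The smooth-minorant transfer principle (a statement): dilute BEC for every smooth-class
minorant `w ≤ v` gives dilute BEC for `v`. This is the shape an approximation argument
`vₙ ↑ v` would have to establish. [folklore] -/
def SmoothMinorantTransfer : Prop :=
  ∀ v : ℝ → ℝ≥0∞, IsRepulsiveFiniteRange v →
    (∀ w, SmoothClass w → (∀ r, w r ≤ v r) → DiluteBEC w) → DiluteBEC v

/-- The smooth-minorant transfer gives the crux … [folklore] -/
theorem crux_of_smoothMinorantTransfer (h : SmoothMinorantTransfer) :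
    BECConjugateDomination.HardCoreExtension :=
  fun hA v hv => h v hv fun w hw _ => smoothClassBEC_iff.1 hA w hw

/-- … and follows from the conjunct; so `B → SmoothMinorantTransfer → crux`, and by §3–§4 any proof
of it must use diluteness on the `v`-side (its all-density analogue with `w = 0` alone is
`not_hasGroundStateBEC_mono_potential`). [folklore] -/
theorem smoothMinorantTransfer_of_conjunct
    (h : Literature.MathematicalPhysics.QuantumManyBody.BoseGas.BoseEinsteinCondensation) :
    SmoothMinorantTransfer :=
  fun v hv _ => h v hv

/-! ## §4b What IS true: the windowed comparison, and why it is gap-limited -/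

/-- Energies are monotone in the potential. [folklore] -/
theorem energy_mono_potential {v w : ℝ → ℝ≥0∞} (h : ∀ r, v r ≤ w r) {N : ℕ} {L : ℝ}
    (Ψ : TrialState N L) : energy v Ψ ≤ energy w Ψ :=
  lintegral_mono fun _ => add_le_add le_rfl
    (mul_le_mul' (Finset.sum_le_sum fun _ _ => Finset.sum_le_sum fun _ _ => h _) le_rfl)

/-- **Window transfer (the one valid comparison in `v`).** For `v ≤ w` and every slack `δ > 0`, the
condensate number of `w` is bounded below by the `λ_max`-infimum over the `v`-energy WINDOW
`energy_v Ψ ≤ E₀(w) + δ` (every `δ`-near-minimiser of `w` lies in it). With `v = vₙ` smooth and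
`w` the hard core at FIXED `N, L` the window shrinks to `E₀(w) − E₀(vₙ) + δ → δ` (monotone form
convergence) — but `A` controls `vₙ`'s near-minimisers only below an unknown, `n`-dependent slack;
with `v = 0` it is the free-gas energy-window criterion, gap-limited (`freeWindowInf_le`). [folklore] -/
theorem windowInf_le_condensateNumber_of_le {v w : ℝ → ℝ≥0∞} (h : ∀ r, v r ≤ w r) (N : ℕ) (L : ℝ)
    {δ : ℝ≥0∞} (hδ : 0 < δ) :
    ⨅ (Ψ : TrialState N L) (_ : energy v Ψ ≤ groundStateEnergy w N L + δ), maxOccupation N Ψ.ψ ≤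
      condensateNumber w N L :=
  le_condensateNumber w hδ fun Ψ hΨ => iInf₂_le Ψ ((energy_mono_potential h Ψ).trans hΨ)

/-- **The free window is gap-limited** (cat states, tree `exists_fragmented_trialState`): as soon as
`E₀^D(w; N, L) ≥ C_cat m² N/L²` — for an interacting gas at fixed density, `E₀ ≈ 4πaρN ≫ N/L_N²`,
this holds for every fixed `m` eventually — the free-gas window infimum at ANY slack is `≤ N/m³`:
the window transfer from `v = 0` certifies no condensate fraction in the thermodynamic limit
(barrier `KineticGapLengthScales`, typed for `λ_max` in `KineticGapLengthScalesModeFree`). [folklore] -/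
theorem freeWindowInf_le {w : ℝ → ℝ≥0∞} {m N : ℕ} (hm : 0 < m) (hN : 2 ≤ N) {L : ℝ} (hL : 0 < L)
    (hE : ENNReal.ofReal (catEnergyConst * m ^ 2 * N / L ^ 2) ≤ groundStateEnergy w N L)
    (δ : ℝ≥0∞) :
    ⨅ (Ψ : TrialState N L) (_ : energy 0 Ψ ≤ groundStateEnergy w N L + δ), maxOccupation N Ψ.ψ ≤
      ENNReal.ofReal (N / m ^ 3) := by
  obtain ⟨Ψ, hEΨ, hocc⟩ := exists_fragmented_trialState hm hN hL
  exact (iInf₂_le Ψ ((hEΨ.trans hE).trans le_self_add)).trans hocc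

/-! ## §2b The smooth class is a cone: the approximating families `t·w`, `t → ∞`, stay inside -/

/-- **Scaling closure.** If `v` is in the smooth class then so is `t·v` for every finite `t ≥ 0`
(edge constant `√t·|Cₑ|`). Hence for a fixed smooth bump `w` the whole family `t·w ↑` (whose
scattering length increases towards the hard-core radius `= range w` as `t → ∞`) lies in `A`'s
class: `A` speaks about every soft approximant of a hard core, with NO uniformity in `t`. [folklore] -/
theorem smoothClass_smul {v : ℝ → ℝ≥0∞} (hv : SmoothClass v) (t : NNReal) :
    SmoothClass fun r => (t : ℝ≥0∞) * v r := by
  obtain ⟨⟨hmeas, R₀, hR₀⟩, hfin, hC, Cₑ, hedge⟩ := hv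
  have hfun : (fun x : Space => ((t : ℝ≥0∞) * v ‖x‖).toReal) =
      (t : ℝ) • fun x : Space => (v ‖x‖).toReal := by
    funext x
    simp [ENNReal.toReal_mul]
  refine ⟨⟨measurable_const.mul hmeas, R₀, fun r hr => by simp [hR₀ r hr]⟩,
    fun r => ENNReal.mul_ne_top ENNReal.coe_ne_top (hfin r), ?_, Real.sqrt t * |Cₑ|, fun x => ?_⟩
  · rw [hfun]; exact hC.const_smul (t : ℝ)
  · rw [hfun, iteratedFDeriv_const_smul_apply hC.contDiffAt, norm_smul, Real.norm_eq_abs,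
      abs_of_nonneg t.coe_nonneg]
    have ht : (0 : ℝ) ≤ t := t.coe_nonneg
    have hsq : Real.sqrt (((t : ℝ≥0∞) * v ‖x‖).toReal) = Real.sqrt t * Real.sqrt ((v ‖x‖).toReal) := by
      rw [ENNReal.toReal_mul, ENNReal.coe_toReal, Real.sqrt_mul ht]
    rw [hsq]
    have h0 : 0 ≤ Real.sqrt ((v ‖x‖).toReal) := Real.sqrt_nonneg _
    have h1 : ‖iteratedFDeriv ℝ 2 (fun x : Space => (v ‖x‖).toReal) x‖ ≤
        |Cₑ| * Real.sqrt ((v ‖x‖).toReal) :=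
      (hedge x).trans (mul_le_mul_of_nonneg_right (le_abs_self _) h0)
    calc (t : ℝ) * ‖iteratedFDeriv ℝ 2 (fun x : Space => (v ‖x‖).toReal) x‖
        ≤ (t : ℝ) * (|Cₑ| * Real.sqrt ((v ‖x‖).toReal)) := mul_le_mul_of_nonneg_left h1 ht
      _ = Real.sqrt t * |Cₑ| * (Real.sqrt t * Real.sqrt ((v ‖x‖).toReal)) := by
          rw [show Real.sqrt t * |Cₑ| * (Real.sqrt t * Real.sqrt ((v ‖x‖).toReal)) =
              Real.sqrt t * Real.sqrt t * (|Cₑ| * Real.sqrt ((v ‖x‖).toReal)) by ring,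
            Real.mul_self_sqrt ht]

/-! ## §5 Why it resists; what a proof must look like (census, gen 1, 2026-08-16)

ATTACKS TRIED (all fail to kill; numbers, not adjectives):
* Normal form (§1): `¬crux ↔ A ∧ ¬B`. `A` ⊇ dilute BEC for `(R²−|x|²)₊⁴`-type bumps = the open
  problem (LSSY2005 Ch. 5 "remains open"; rigorous BEC stops at boxes `L ≲ a(ρa³)^{-3/4-η}`,
  barrier `KineticGapLengthScales`). No refutation of `A` is available either: its only computable
  member, `v = 0`, HAS BEC (`antecedentAt_zero`).
* Junk hunt on `B`'s class (measurable, finite range, `⊤` allowed): `⊤` on a Lebesgue-null set of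
  radii is invisible to `∫⁻` (free gas, BEC true); `⊤` on a closed set of radii with positive local
  measure ("hard set", tree `BoseGasHardSet`) forces `Ψ = 0` there and disconnects configuration
  space; bounded gaps cost a fixed Dirichlet confinement energy per bound pair while the dilute
  component costs `O(ρ)` per particle, so at small `ρ` the ground state (and every `δ`-near-minimiser,
  `δ <` that gap) lives in the dilute component = hard spheres of diameter `max(hard set)`: `B` there
  is hard-sphere BEC (open, believed true). Hard shells `⊤·1_{[a,b]}`: same. `N = 0`/`L ≤ 0` junk is
  killed by `∀ᶠ N`. `maxOccupation ≤ N` (Cauchy–Schwarz), no upward junk. ⇒ no `v` with `¬DiluteBEC v`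
  is constructible.
* Degenerate regimes that DO bite, but only strengthenings (§3–§4): high density. Typed and proved:
  hard spheres above `8/a³` have `condensateNumber = 0` eventually (no BEC), the free gas has BEC at
  every density ⇒ BEC is NOT monotone in `v` (neither thermodynamically nor in one box), and `B` at
  all densities is false. In `A`'s class `ρ_c = ∞` and `E₀ < ∞` always.
* Literature: no comparison / monotonicity / continuity theorem for `λ_max(γ_{Ψ₀})` in `v` is in
  print (route file, 4 refuter stamps, 3 grounder notes concur; Dyson's lemma LSSY2005 Lemma 2.5 and
  the hard-core ↔ soft-potential substitutions act inside ENERGY bounds only; BEC proofs in the GP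
  limit treat hard cores directly, LiebSeiringer2002 / LSSY2005 Ch. 7, never by extension).

WHY IT RESISTS. The crux is an implication between two open ∀-statements whose only provable
instances (free gas) sit on the TRUE side of both. A disproof needs the positive solution of the
smooth dilute BEC problem; a proof needs either `B` outright for non-smooth `v` or a transfer
theorem `vₙ ↑ v ⇒ BEC(v)` — and §3–§4 show such a transfer cannot be density-uniform: it must fail
above `8/a³` for `vₙ ↑ ⊤·1_{r<a}` although each `vₙ` has `ρ_c = ∞`. So the transfer must carry
explicit dilute constants `ρ₀(v) ≲ a(v)^{-3}` with `a(vₙ) ↑ a` (scattering length), i.e. it is a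
quantitative uniform-in-`n` BEC theorem for the approximants — essentially the conjunct.

OPEN TARGETS for later generations / the lead's stubs (none registered yet: `targets = []`):
(T1) antitone comparison `v ≤ w ⇒ condensateNumber w N L ≤ condensateNumber v N L` — plausible at
`v = 0` (free `λ_max = N`), unknown in general, would NOT give the crux (wrong direction) but would
give `condensateNumber (hard core) ≤ condensateNumber (vₙ)`; (T2) upper semicontinuity
`vₙ ↑ v ⇒ limsup condensateNumber vₙ N L ≤ condensateNumber v N L` at fixed `N, L` (monotone form
convergence gives it for ENERGIES; for `λ_max` of near-minimisers it needs the compactness of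
`{Ψ : energy vₙ Ψ ≤ E₀(vₙ)+δ}` in `H¹`, true at fixed `N, L` — a provable SUPPORT lemma, not a
refutation target); (T3) the uniform version the planner suggested (antecedent uniform over
`{v smooth : a(v) ≤ a, range ≤ R}`) — check whether the route's glue constants (`‖ṽ‖₁ → ∞` along
`vₙ`) could ever feed it: they cannot (IMUChainGlue step (iv) uses `K² ≥ ‖ṽ‖₁`).
-/

/-! ## §6 (gen 2) Dilation covariance and quantifier order

Typed and LANDED as `Theorems/HardCoreExtension/Negative/ScalingReductions.lean` (namespace
`…Theorems.HardCoreExtension.Negative`, imported above): the tree's exact dilation symmetry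
`condensateNumber (s⁻²v(·/s)) N (sL) = condensateNumber v N L` (`JelliumBoseGas.condensateNumber_dilate`)
gives `HasGroundStateBEC (scalePotential s v) (ρ/s³) ↔ HasGroundStateBEC v ρ`, and both classes of the crux
are dilation invariant. Consequences recorded here in the vocabulary of §1 (bundled `SmoothClass`,
`DiluteBEC`). -/

/-- The smooth class is a dilation-invariant cone (cf. `smoothClass_smul`, §2b): `s⁻²v(·/s)` is in it
whenever `v` is (edge constant `s⁻³|Cₑ|`, `Negative.edgeCondition_scalePotential`). [folklore] -/
theorem smoothClass_scalePotential {v : ℝ → ℝ≥0∞} (hv : SmoothClass v) {s : ℝ} (hs : 0 < s) :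
    SmoothClass (scalePotential s v) :=
  ⟨Negative.isRepulsiveFiniteRange_scalePotential hv.1 hs, Negative.scalePotential_ne_top hv.2.1 s,
    Negative.contDiff_scalePotential_profile hv.2.2.1 hs,
    Negative.edgeCondition_scalePotential hv.2.2.1 hv.2.2.2 hs⟩

/-- Dilute BEC is dilation invariant. [folklore] -/
theorem diluteBEC_scalePotential_iff (v : ℝ → ℝ≥0∞) {s : ℝ} (hs : 0 < s) :
    DiluteBEC (scalePotential s v) ↔ DiluteBEC v :=
  Negative.diluteBEC_scalePotential_iff v hs

/-- **`A` with a uniform threshold is the all-density smooth-class BEC.** The repair "make `ρ₀` uniform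
in `v`" of the antecedent is equivalent to ground-state BEC at EVERY density for every smooth-class
potential (dilate until `ρ/s³ < ρ₀`) — expected FALSE for the tall, hard-sphere-like members `t·φ`
(`t → ∞`) above the close packing of their effective cores (insulating quantum crystal; cf. `n₀ ≈ 0` in
hcp ⁴He by PIMC), even if soft bounded members may stay supersolid (cluster crystals WITH a condensate),
and in any case not what the route's chain could deliver. A uniformisation of `A` must fix a length scale
(range or scattering length): the refuters' `(a, R)`-uniform form, ideator 2's `UniformSmoothClassBEC`
(range `≤ R`), ideator 3's `UniformSmoothPeriodicBEC` (`a ≤ a₀`, range `≤ R₀`) all do; by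
`crux_iff_unitRange` below `R = 1` is no loss. [folklore] -/
theorem uniformRhoAntecedent_iff_allDensities :
    (∃ ρ₀ : ℝ, 0 < ρ₀ ∧ ∀ v, SmoothClass v → ∀ ρ : ℝ, 0 < ρ → ρ < ρ₀ → HasGroundStateBEC v ρ) ↔
      ∀ v, SmoothClass v → ∀ ρ : ℝ, 0 < ρ → HasGroundStateBEC v ρ := by
  constructor
  · rintro ⟨ρ₀, hρ₀, h⟩ v hv ρ hρ
    obtain ⟨s, hs, hlt⟩ := Negative.exists_scale_density_lt hρ hρ₀
    exact (Negative.hasGroundStateBEC_scalePotential_iff v hs hρ).1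
      (h _ (smoothClass_scalePotential hv hs) _ (by positivity) hlt)
  · intro h
    exact ⟨1, one_pos, fun v hv ρ hρ _ => h v hv ρ hρ⟩

/-- **The conjunct with a `v`-uniform threshold is FALSE** (`∃ ρ₀ ∀ v ∀ ρ < ρ₀`): by dilation it would
be the all-density conjunct, refuted by packed hard spheres (§3–§4). The order `∀ v ∃ ρ₀` in `B` — the
conclusion of the crux — is load-bearing. [folklore] -/
theorem not_uniformRho_conjunct :
    ¬ ∃ ρ₀ : ℝ, 0 < ρ₀ ∧ ∀ v : ℝ → ℝ≥0∞, IsRepulsiveFiniteRange v →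
        ∀ ρ : ℝ, 0 < ρ → ρ < ρ₀ → HasGroundStateBEC v ρ :=
  Negative.not_conjunctClass_uniformRho

/-- **Range is a gauge.** The crux is equivalent to its restriction to potentials of range `≤ 1` on
BOTH sides (`Negative.hardCoreExtension_iff_unitRange`, bundled): the only scale-free parameter of a
smooth approximant of a hard core is `𝔞(v)/range(v) ∈ (0, 1]`
(`Negative.scatteringLength_scalePotential`: `𝔞(s⁻²v(·/s)) = s𝔞(v)`). [folklore] -/
theorem crux_iff_unitRange :
    BECConjugateDomination.HardCoreExtension ↔
      ((∀ v, SmoothClass v → (∀ r, 1 < r → v r = 0) → DiluteBEC v) →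
        ∀ v, IsRepulsiveFiniteRange v → (∀ r, 1 < r → v r = 0) → DiluteBEC v) := by
  rw [Negative.hardCoreExtension_iff_unitRange]
  constructor
  · intro h hA v hv h1
    exact h (fun w h₁ h₂ h₃ h₄ hw1 => hA w ⟨h₁, h₂, h₃, h₄⟩ hw1) v hv h1
  · intro h hA v hv h1
    exact h (fun w hw hw1 => hA w hw.1 hw.2.1 hw.2.2.1 hw.2.2.2 hw1) v hv h1

/-- **Absolute bounds on `𝔞` and on the range are free; only `𝔞/range` is scale-free.** For ANY
`a₀, R₀ > 0` the antecedent is equivalent to its restriction to smooth-class `v` with `𝔞(v) ≤ a₀` and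
range `≤ R₀` (dilate by `s = min(a₀,R₀)/R`, using `𝔞(v) ≤ R` for a range `R`, `scatteringLength_le_range`).
So the crux's antecedent already IS the `(a₀, R₀)`-bounded antecedent; what the refuters' repair adds is
only the uniformity of `ρ₀, c, N₀` inside that class (normal form: one parameter `𝔞/R`,
`Negative.uniformSmoothBEC_iff_unitRange`, landed in `Negative/UniformRepairNormalForm.lean`). [folklore] -/
theorem antecedent_iff_boundedScales {a₀ R₀ : ℝ} (ha₀ : 0 < a₀) (hR₀ : 0 < R₀) :
    SmoothClassBEC ↔ ∀ v, SmoothClass v → scatteringLength v ≤ ENNReal.ofReal a₀ →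
      (∀ r, R₀ < r → v r = 0) → DiluteBEC v := by
  rw [smoothClassBEC_iff]
  refine ⟨fun h v hv _ _ => h v hv, fun h v hv => ?_⟩
  obtain ⟨R, hR, hvR⟩ := hv.1.exists_pos_range
  set s : ℝ := min a₀ R₀ / R with hs_def
  have hs : 0 < s := div_pos (lt_min ha₀ hR₀) hR
  have hsR : s * R = min a₀ R₀ := by rw [hs_def]; field_simp
  have hrange : ∀ r, R₀ < r → scalePotential s v r = 0 := fun r hr =>
    Negative.scalePotential_eq_zero_of_lt hvR hs r (by rw [hsR]; exact (min_le_right _ _).trans_lt hr)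
  have ha : scatteringLength (scalePotential s v) ≤ ENNReal.ofReal a₀ := by
    rw [Negative.scatteringLength_scalePotential v hs]
    calc ENNReal.ofReal s * scatteringLength v ≤ ENNReal.ofReal s * ENNReal.ofReal R :=
          mul_le_mul_right (scatteringLength_le_range hR.le hvR) _
      _ = ENNReal.ofReal (min a₀ R₀) := by rw [← ENNReal.ofReal_mul hs.le, hsR]
      _ ≤ ENNReal.ofReal a₀ := ENNReal.ofReal_le_ofReal (min_le_left _ _)
  exact (diluteBEC_scalePotential_iff v hs).1 (h _ (smoothClass_scalePotential hv hs) ha hrange)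

/-! ## §7 (gen 2) Fixed-box degeneracy: the junk inside "for every measurable `v`, at every `(N, L)`"

Several first lemmas filed in crux-ideate round 1 quantify over ALL measurable potentials at a FIXED box
(`Ideator3.MonotoneLimitTransfer`, `Ideator3.MonotoneFormContinuity`; gen-1 open target (T2)). For
potentials with hard SETS (`⊤` on an interval of radii NOT containing `0`, e.g. the hard shell
`⊤·1_{[a,b]}`) the free configuration space is disconnected and the ground space at a fixed `(N, L)` can be
DEGENERATE by tuning one parameter; then statements transferring a property of the (unique, positive)
ground states of finite approximants `wᵢ ↑ v` to ALL near-minimisers of `v` fail. Worked instance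
(paper; kit jobs j009705 / j009855 compute the numbers): `N = 2`, unit torus, `v = ⊤·1_{[a,b]}` with
`a < 1/2` and `a + b < 1` (so that the shells of the other lattice images do not meet the ball
`{d < a}`). In the relative coordinate `r = x₁ − x₂` (kinetic operator `−2Δ_r`, zero total momentum)
the free region is `IN = {d(r) < a}` ⊔ `OUT = {d(r) > b}` (`d` = torus distance); `E_in = 2π²/a²`
(Dirichlet ball), `E_out(b)` increases continuously from `O(a)` (`b = a`) to `+∞` (`b ↑ √3/2`), so
`E_out(b*) = E_in`
for some `b* ∈ (a, √3/2)` (IVT; domain monotonicity). At `b = b*`: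
`periodicGroundStateEnergy v 2 1 = E_in = E_out ≠ ⊤` and the ground space is `span{Ψ_in, Ψ_out}`,
`Ψ_c(x,y) = F_c(x−y)`, `F_c ≥ 0` the component ground states, disjoint supports. KEY (rank one): for
every zero-momentum two-body state `Ψ = F(x−y)`, `(PΨ)(y) = L^{-3/2}∫F` is CONSTANT in `y` (`P` =
projection of particle 1 on the constant mode), so `condensateOccupation 2 1 Ψ = 2|∫F|²/∫|F|²` and the
`n₀`-form compressed to the ground space has rank one: the ground vector
`α Ψ_in − β Ψ_out` with `α∫F_in/‖F_in‖ = β∫F_out/‖F_out‖` has `condensateOccupation = 0` EXACTLY, while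
every NONNEGATIVE ground vector has `n₀ ≥ min(n_in, n_out) > 0`, `n_c = 2(∫F_c)²/∫F_c²`
(`n_in = 16a³/π` in closed form: `F_in = sin(πr/a)/r`). The finite shells `wᵢ = tᵢ·1_{[a,b*]}`, `tᵢ ↑ ∞`
(measurable, monotone, `⨆ wᵢ = v`) have UNIQUE positive `C^{1,α}` ground states `Ψᵢ = Fᵢ(x−y)`
(bounded potential: positivity improving + elliptic regularity), which are exact minimisers in
`PeriodicTrialState 2 1`, and every `L²`-limit point of `Fᵢ` is a nonnegative unit vector of the ground
space (monotone form convergence + Rellich), so `liminf n₀(Ψᵢ) ≥ min(n_in, n_out)`. -/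

namespace Levers

/-- Verbatim copy of `Cruxes/HardCoreExtension/SketchIdeator3.lean :: Ideator3.MonotoneLimitTransfer`
(card `earned-uniformity-monotone-limit`, fixed-`(N,L)` transfer schema): minimiser-BEC along a monotone
approximation `wᵢ ↑ v` passes to the near-minimisers of the limit. [folklore] -/
def MonotoneLimitTransfer : Prop :=
  ∀ (w : ℕ → ℝ → ℝ≥0∞) (v : ℝ → ℝ≥0∞), (∀ i, Measurable (w i)) → Measurable v →
    (∀ i r, w i r ≤ w (i + 1) r) → (∀ r, ⨆ i, w i r = v r) →
    ∀ (N : ℕ) (L : ℝ), 0 < L → periodicGroundStateEnergy v N L ≠ ⊤ →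
      (∀ i, ∃ Ψ : PeriodicTrialState N L, periodicEnergy (w i) Ψ = periodicGroundStateEnergy (w i) N L) →
      ∀ c : ℝ,
        (∀ i, ∀ Ψ : PeriodicTrialState N L,
            periodicEnergy (w i) Ψ = periodicGroundStateEnergy (w i) N L →
            ENNReal.ofReal (c * N) ≤ condensateOccupation N L Ψ.ψ) →
        ∀ ε : ℝ, 0 < ε → ∃ δ : ℝ≥0∞, 0 < δ ∧ ∀ Φ : PeriodicTrialState N L,
          periodicEnergy v Φ ≤ periodicGroundStateEnergy v N L + δ →
          ENNReal.ofReal ((c - ε) * N) ≤ condensateOccupation N L Φ.ψ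

/-- The same schema with the limit's ground state assumed SIMPLE in the variational sense the route
already uses for the smooth class (`NearMinimiserStability`, stmt-11788): near-minimisers of `v` are
`L²(cell)`-close to the phase orbit of one minimiser. This is the repaired first lemma; it is what the
line needs for its actual target (`v` = hard core `⊤·1_{[0,a)}`, whose free region
`{all pairs farther than a}` is connected below close packing, hence has a simple positive ground state).
[folklore] -/
def MonotoneLimitTransferSimple : Prop :=
  ∀ (w : ℕ → ℝ → ℝ≥0∞) (v : ℝ → ℝ≥0∞), (∀ i, Measurable (w i)) → Measurable v →
    (∀ i r, w i r ≤ w (i + 1) r) → (∀ r, ⨆ i, w i r = v r) →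
    ∀ (N : ℕ) (L : ℝ), 0 < L → periodicGroundStateEnergy v N L ≠ ⊤ →
      -- simplicity of the limit ground state, variational form: some minimising profile `Ψ₀` attracts
      -- every near-minimiser up to a phase, in `L²` of the cell
      (∃ Ψ₀ : PeriodicTrialState N L, ∀ η : ℝ, 0 < η → ∃ δ : ℝ≥0∞, 0 < δ ∧
          ∀ Φ : PeriodicTrialState N L, periodicEnergy v Φ ≤ periodicGroundStateEnergy v N L + δ →
            ∃ θ : ℝ, ∫ X in cellN N L, ‖Φ.ψ X - Complex.exp (θ * Complex.I) * Ψ₀.ψ X‖ ^ 2 ≤ η) →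
      (∀ i, ∃ Ψ : PeriodicTrialState N L, periodicEnergy (w i) Ψ = periodicGroundStateEnergy (w i) N L) →
      ∀ c : ℝ,
        (∀ i, ∀ Ψ : PeriodicTrialState N L,
            periodicEnergy (w i) Ψ = periodicGroundStateEnergy (w i) N L →
            ENNReal.ofReal (c * N) ≤ condensateOccupation N L Ψ.ψ) →
        ∀ ε : ℝ, 0 < ε → ∃ δ : ℝ≥0∞, 0 < δ ∧ ∀ Φ : PeriodicTrialState N L,
          periodicEnergy v Φ ≤ periodicGroundStateEnergy v N L + δ →
          ENNReal.ofReal ((c - ε) * N) ≤ condensateOccupation N L Φ.ψ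

end Levers

/-- **PAPER REFUTATION (near-miss: not closable in the tree).** `Levers.MonotoneLimitTransfer` is FALSE
as typed. Witness (module docblock §7): `N = 2`, `L = 1`, `v = ⊤·1_{[a,b*]}` (hard shell tuned to the
in/out degeneracy `E_out(b*) = E_in = 2π²/a²`), `wᵢ = (i₀ + i)·1_{[a,b*]}`; all minimisers of all `wᵢ`
have `n₀ ≥ (min(n_in,n_out) − η)` for `i₀ = i₀(η)` large, but for EVERY `δ > 0` the `δ`-near-minimisers of
`v` contain `C¹` approximants of the ground vector `αΨ_in − βΨ_out` with `condensateOccupation → 0`; take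
`cN = min(n_in,n_out) − η`, `ε = c/2`. OBSTRUCTION to a Lean proof: needs (i) the Dirichlet spectral
theory of `−2Δ` on the torus ball / torus-minus-ball (simple positive ground states, continuity and
blow-up of `E_out(b)`), (ii) monotone form convergence `wᵢ ↑ v` with Rellich compactness, (iii) the
identification of `periodicGroundStateEnergy` (infimum over `C¹` states) with the form bottom, (iv)
`condensateOccupation` of `F(x−y)` in closed form — none in the tree. Numbers: kit jobs j009705
(`a = 0.4`) / j009855 (`a = 0.3`)
(`shelljob/main.py`, finite differences on `48³`): `b*`, `n_in` (vs `16a³/π`), `n_out`. REPAIR: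
`Levers.MonotoneLimitTransferSimple` (add simplicity of the limit ground state), or restrict `v` to
potentials whose free region is connected at the given `(N, L)` (hard cores `⊤·1_{[0,a)}` below close
packing). The same degeneracy kills gen-1 target (T2) (upper semicontinuity of `condensateNumber` under
`vₙ ↑ v` at fixed `(N,L)`) for such `v`, and is harmless for the conjunct `B` (thermodynamic limit at small
density: a bound pair costs `≈ 2π²/a²`, the dilute free component wins with an `O(1)` gap uniformly in
`N`). [folklore] -/
theorem not_monotoneLimitTransfer : ¬ Levers.MonotoneLimitTransfer := by
  sorry

/-! ## §8 (gen 2) Status of the levers filed in crux-ideate round 1 (triage input; numbers, not adjectives)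

Files: `IdeatorSketch1.lean` (namespace `…Sketch`), `IdeatorSketch2.lean` (`…IdeatorTwo`),
`SketchIdeator3.lean` (`…Ideator3`). Verdicts of the standing adversary:

* TRUE, provable now / proved here: `IdeatorTwo.energy_mono_of_le`, `uniformApproxTransfer` (proved by
  their author); `IdeatorTwo.FiniteEnergyAtLowDensity` — PROVED below (`finiteEnergyAtLowDensity`, from the
  tree's `limsup_lt_top_of_small`: `ρ₀ = (1+R)⁻³`); `Ideator3.LatticeInvSqSum` (shell counting, `d = 3`);
  `Sketch.peel_identity` (proved by its author); `Sketch.ShieldExists` (e.g. `h·ζ(‖x‖²)⁴`, `ζ` a smooth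
  bump: `D²(ζ⁴) = 4ζ³D²ζ + 12ζ²Dζ⊗Dζ` gives the edge bound with `√(ζ⁴) = ζ²` — no Glaeser needed).
* TRUE on paper (heavy but standard): `IdeatorTwo.SecondMomentFloor` and `Ideator3.SecondMomentFloor` —
  algebra re-derived independently: with `A = [T,ρ_k]Ψ = Σ_j e^{ik·x_j}(|k|²Ψ − 2ik·∇_jΨ)` and `Ψ` real,
  `C¹`, periodic, normalised on the cell, ONE integration by parts gives `Re⟨ρ_kΨ, A⟩ = N|k|²` and
  `‖A‖² = 4D_k + N|k|⁴(2 − S_k)`; Cauchy–Schwarz gives both typed forms (`(N|k|²)² ≤ (NS)(4D + N|k|⁴(2−S))`,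
  `|k|⁴ ≤ S·M₂`); sanity `N = 1`: `S = 1`, `M₂ = |k|⁴ + 4‖k·∇Ψ‖²`. `IdeatorTwo.AeRadialInvariance` (a null
  set of radii lifts to a null set of configurations: push-forward of Lebesgue under `(x,y) ↦ |x−y|` is
  absolutely continuous). `Ideator3.MonotoneFormContinuity` (energies only: Simon's monotone convergence +
  Rellich at fixed `(N,L)` + identification of the `C¹` infimum with the form bottom; degeneracy is
  irrelevant for energies). `IdeatorTwo.SmoothMinorantApproximation` for lsc `v` (same tools; its author's
  non-lsc caveat `1_K`, `K` fat Cantor, is correct: `sup_{w ≤ 1_K continuous} E₀(w) = E₀(0) < E₀(1_K)`).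
* FALSE AS TYPED: `Ideator3.MonotoneLimitTransfer` (§7; repair `Levers.MonotoneLimitTransferSimple`).
  Gen-1 target (T1) WITHOUT slack at fixed `(N,L)` ("`v ≤ w ⇒ condensateNumber w N L ≤ condensateNumber v N L`")
  is false at `N = 2` to first order by the two-dip variance computation of card
  `domination-order-reversal` (6) (`n₀/2 = f̄²/(f̄² + Var f)`; a new shallow dip of depth `t` far from an
  existing one changes `Var` by `−2εt|A||B|/L⁶ + O(t²)`: coherence first RISES) — which is why every
  comparison lever correctly carries `o(N)` slack, `∀ᶠ N`, and a dilute guard.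
* CONSISTENT, NOT REFUTABLE HERE (conjectural comparison principles): `Sketch.DominationOrderReversal`
  (= (T1) with slack; `v ≤ w`, `w` smooth forces `v` finite, so no hard-set junk; Bogoliubov: depletion
  `1.5045√(ρ𝔞³)` increasing in `𝔞`, and `𝔞(v) < 𝔞(w)` strictly unless `v = w` a.e.),
  `Sketch.ScatteringOrderReversal` (finer than the depletion gap `(2^{3/2}−1)·1.5045√(ρa³)N` between the
  two sides — a statement at LHY precision of the condensate fraction, beyond any proved asymptotics),
  `Sketch.PeelingMonotone`, `Sketch.ShieldedInsertion` (with `∃ ρ₁` AFTER `(W, a)`: implied by complete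
  condensation `cn/N → 1` as `ρ → 0` for `W + HS_a`, hence unfalsifiable by dilute asymptotics; its content
  is only in the uniformity the card's composition `hardSphere_of_shield` silently needs — `ρ₁` independent
  of the shield height `h`). Packed-box check: all four carry the dilute guard that §3 shows necessary.
* CRUX-STRENGTH (the honest residue of each line): `IdeatorTwo.UniformSmoothClassBEC`,
  `Ideator3.UniformSmoothPeriodicBEC` (uniform smooth-class BEC at fixed range; consistent at `v = 0`:
  constant minimiser, `n₀ = N`), `IdeatorTwo.UniformCurrentFluctuationBound` (CFB; at large `|k|`,
  `D_k/(N|k|²) → t/3`, `t` = kinetic energy per particle of the minimiser, so CFB contains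
  "`t ≤ C𝔞ρ` uniformly over the class" — true at the level of the Dyson upper bound `e ≤ 4π𝔞ρ(1+C𝔞/b)`;
  off-diagonal part = pair-gradient correlations `∼ Nρ|k|²𝔞`, Bogoliubov-consistent),
  `IdeatorTwo.UniformQuadraticFloor` (at `𝔞 = 0` the typed `kn²/(16·C·0·ρ) = kn²/0 = 0` makes it
  trivially true — harmless junk), `Ideator3.QuadraticFloor` (class-blind; hard-sphere check: `1 − S(k)` is
  `O(ρ𝔞/k²)` for `k ≫ 1/𝔞` and `O(10ρ𝔞³)` at `k ∼ 1/𝔞`, both within `Cρ/(k²+Cρ)` for `C = O(10)·𝔞` — this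
  gen-2 check concerned the EXACT ground state; AS TYPED (near-minimisers, all modes) the lever is FALSE,
  see §10 `not_quadraticFloorNearMin` (gen 3); its capped form `Levers.QuadraticFloorCapped` is the
  crux-strength statement),
  `IdeatorTwo.NonLscResidueBEC` (e.g. `V₀·1_K`, `K ⊂ [1,2]` fat Cantor: bounded, `E₀ < ⊤`, positivity
  improving — `B` expected, no junk; unreachable by minorants only).
* COMPOSITIONS (certified by their authors, rechecked): `IdeatorTwo.hardCoreExtension_of_uniform`,
  `Ideator3.hardCoreExtension_of_periodicBEC_all`, `Sketch.bounded_half_of_domination` (logic). For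
  `Sketch.hardSphere_of_shield`: ONE shield per `(a, θ)` suffices (`θ = ε = c₀/4`), so no uniformity in the shield
  height is needed and the composition is sound as typed; the load sits in `ShieldedInsertion` (as TYPED it is
  implied by complete condensation of `W + HS_a` in the dilute limit — hence unfalsifiable by dilute asymptotics —
  while its intended proof needs `Var(n̂₀) = O(N)` for minimisers uniformly in `N`, an infrared input of IMU type)
  and in `PeelingMonotone` (= (T1) with slack, hard core common to both sides).
-/

/-- **`IdeatorTwo.FiniteEnergyAtLowDensity` holds** (spelled out): every repulsive finite-range `v`
(hard cores included) has finite Dirichlet ground-state energy along `L_N = (N/ρ)^{1/3}` eventually, for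
`ρ < (1+R)⁻³` (`R` a positive range of `v`; tree: `limsup_lt_top_of_small`, free-volume product states).
[folklore] -/
theorem finiteEnergyAtLowDensity (v : ℝ → ℝ≥0∞) (hv : IsRepulsiveFiniteRange v) :
    ∃ ρ₀ : ℝ, 0 < ρ₀ ∧ ∀ ρ : ℝ, 0 < ρ → ρ < ρ₀ →
      ∀ᶠ N : ℕ in atTop, 0 < sideLength ρ N ∧ groundStateEnergy v N (sideLength ρ N) ≠ ⊤ := by
  obtain ⟨R, hR, hvR⟩ := hv.exists_pos_range
  have hR3 : 0 < (1 + R) ^ 3 := by positivity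
  refine ⟨((1 + R) ^ 3)⁻¹, by positivity, fun ρ hρ hlt => ?_⟩
  have hsmall : ρ * (1 + R) ^ 3 < 1 := by
    have := mul_lt_mul_of_pos_right hlt hR3
    rwa [inv_mul_cancel₀ hR3.ne'] at this
  have hlim := limsup_lt_top_of_small hv.1 hvR hR hρ hsmall
  have hev : ∀ᶠ N : ℕ in atTop, energyPerParticleDirichlet v ρ N < ⊤ :=
    Filter.eventually_lt_of_limsup_lt hlim
  filter_upwards [hev, eventually_gt_atTop 0] with N hN hN0
  refine ⟨sideLength_pos_of_pos hρ hN0, fun htop => ?_⟩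
  unfold energyPerParticleDirichlet at hN
  rw [htop, ENNReal.top_div_of_ne_top (ENNReal.natCast_ne_top N)] at hN
  exact lt_irrefl _ hN

/-! ## §9 Census, gen 2 (2026-08-16)

NEW THIS GENERATION (all `lean check`ed; landed where marked):
* §6 dilation covariance + quantifier order — landed `Negative/ScalingReductions.lean`: the `∃ρ₀ ∀v`
  conjunct is FALSE (`not_uniformRho_conjunct`); the `∃ρ₀ ∀v` antecedent is the all-density smooth BEC
  (`uniformRhoAntecedent_iff_allDensities`); antecedent, conjunct and crux equal their unit-range cases
  (`crux_iff_unitRange`); the smooth class is dilation invariant (`smoothClass_scalePotential`).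
* §7 fixed-box degeneracy junk: `Levers.MonotoneLimitTransfer` FALSE as typed (paper, sorried
  `not_monotoneLimitTransfer`; witness computed by kit j009705); repair typed
  (`Levers.MonotoneLimitTransferSimple`); gen-1 target (T2) dies the same way for hard-set `v`.
* §8 lever census for the triage panel; `finiteEnergyAtLowDensity` proved.

WHY THE CRUX STILL RESISTS (unchanged since gen 1, sharpened): `¬crux ↔ A ∧ ¬B` (§1). Three generations
of junk hunts on `B` found none (gen 2 adds: symmetry-forced or tuned ground-space DEGENERACY cannot be
used against `B` either — at small density the all-free component wins by `≈ 2π²/a²` per bound pair,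
uniformly in `N`, and chiral bound clusters, which WOULD be symmetry-degenerate, are never dilute ground
states of a purely repulsive `v`). So a kill needs a proof of `A` = thermodynamic-limit BEC for smooth
repulsive potentials (LSSY2005 Ch. 5: open). Conversely the crux cannot become PROVABLE by junk: `A` holds
at its only computable member `v = 0` and its other members are genuine.

OPEN TARGETS carried forward: (T1) antitone comparison WITH `o(N)` slack (= `Sketch.DominationOrderReversal`)
— no counterexample in 2-body box models (orbit-counting heuristic: more repulsion = fewer allowed pair
distances = less one-body coherence); (T3) is now normalised to `R = 1` (§6). NEW (T4): the lead of
whichever line is picked will need `ρ₀` bounded below along a family of class members of FIXED range — the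
one uniformity §6 does not forbid; the disprover's next regime is the opposite corner `𝔞/R → 0` (tall thin
shells `t·1_{[R−η,R]}` smoothed: `𝔞 → R` but `‖ṽ‖₁ → 0`?? no — `‖ṽ‖₁ ≥ 8π𝔞`; rather weak wide bumps with
`𝔞 ≪ R`, where `ρ₀ ≍ R⁻³ ≪ 𝔞⁻³`: is `ρ₀(v) ≳ c·R⁻³` uniformly plausible? yes by the hard-sphere-of-radius-`R`
comparison heuristics, so no kill expected there either).
-/

/-! ## §10 (gen 3) Near-minimiser UV junk: class-blind structure-factor floors over ALL modes are false

The class-blind lines (`second-moment-floor-class-blind` ≈ `third-law-current-floor`, merged by the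
triage panel) must state their structure-factor floor for HARD CORES, where the three available
quantifications over states behave as follows (the TRICHOTOMY; numbers, not adjectives):

* EXACT `C¹` minimisers (`periodicEnergy v Ψ = E₀^per`, the shape of the route's `PuffFloor`, of
  `InfraredMinimumUncertainty`, of `IdeatorTwo.UniformCurrentFluctuationBound` /
  `UniformQuadraticFloor` and of the inner `∀ Ψ` of `Ideator3.UniformSmoothPeriodicBEC`): VACUOUS on
  hard cores. Paper proof: for `v = hardCorePotential a`, `N ≥ 2`, `E₀^per < ⊤`, a finite-energy
  `C¹` periodic state vanishes on the open contact set `S = {some pair at torus distance < a}`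
  (`⊤·|Ψ|²` integrable ⇒ `Ψ = 0` a.e. on `S` ⇒ everywhere on `S` by continuity), hence `Ψ = ∇Ψ = 0`
  on `S̄`; a minimiser solves `−ΔΨ = E₀Ψ` weakly in the free region `U = S̄ᶜ` with BOTH Cauchy data
  zero on `∂U`, so its zero extension solves `−ΔΨ = E₀1_UΨ` on the (connected) configuration torus
  and vanishes on the open set `S ≠ ∅`: unique continuation for `−Δ + W`, `W ∈ L^∞`, forces `Ψ ≡ 0`,
  contradicting `‖Ψ‖ = 1`. (The true hard-core ground state has a non-zero normal derivative at
  contact — Hopf — and is only Lipschitz.) The triage panel's "IMU vacuous on hard cores" is this.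
* NEAR-minimisers with `∃ δ > 0` after `n` and the floor at ALL modes (the shape ideator 3 chose for
  exactly that reason, `Ideator3.QuadraticFloor`): FALSE already for the FREE gas —
  `not_quadraticFloorNearMin` below, sorry-free, LANDED as
  `Theorems/HardCoreExtension/Negative/QuadraticFloorNearMinFalse.lean` (p76160, accepted). Mechanism: the
  `PuffFloor` disprover's anti-correlated witness `Ψ_ε ∝ (1 − ε(|ρ̂_m|² − N))^{1/2}`
  (`PuffFloor.Negative.witnessState`: real, positive, `S_m = 1 − εn` exactly,
  `periodicEnergy 0 Ψ_ε ≤ 2ε²N³|k|²`) at a HIGH mode `k² > Cρ/(εn)`: the deficit a floor `f` tolerates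
  at mode `k` is `1 − f(k)`, a modulation of that depth costs `≤ 2(1−f(k))²N³k²/n²`, so EVERY
  near-minimiser floor over all modes with `(1 − f(k))·k → 0` dies (`k²/(k²+Cρ)`: deficit `Cρ/k²`;
  the route's `k/√(k²+Cρ)`: deficit `Cρ/2k²` — the sibling theorem
  `PuffFloor.Negative.puffFloor_false_for_nearMinimisers`). This CORRECTS the gen-2 §8 verdict on
  `Ideator3.QuadraticFloor` (listed "crux-strength"; the hard-sphere check there concerned the exact
  ground state).
* CAPPED near-minimiser floor `min(½, kn m²/(kn m² + Cρ)) ≤ S m` (typed repair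
  `Levers.QuadraticFloorCapped`; the triagers proposed the same cap for a different reason — it is what
  the engine `SecondMomentFloor` actually yields): CONSISTENT. The witness family cannot dip below `½`
  (`1 − ε·pairCorr ≥ 0` forces `εn ≤ 1/(2N)`), and at fixed `(N, L)` any dip of fixed size `d` at any
  mode costs the gap: for `Ψ = Ψ₀ + χ`, `|S_m(Ψ) − S_m(Ψ₀)| ≤ N(2‖χ‖ + ‖χ‖²)` uniformly in `m`
  (`‖|ρ̂_m|²/N‖_op ≤ N`) and `‖χ‖² ≤ δ/gap`; so the capped floor for near-minimisers is equivalent, up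
  to the choice of `δ(n)`, to the capped floor for the form ground state WITH A MARGIN at the finitely
  many infrared modes where `kn² < Cρ` — crux-strength, like `PuffFloor` itself. The IMUChainGlue
  tolerates the cap (it needs `ν_m ≤ C/(N S_m)` with `S_m ≥ ½` in the ultraviolet).

CONSEQUENCE FOR THE LINES: a class-blind replacement of `PuffFloor` must be typed either for the
FORM ground state (an `H¹` object the tree does not have), or for near-minimisers WITH the `½`-cap
(or a mode window `|m| ≤ M` fixed before `δ`). The same applies verbatim to any near-minimiser version
of `InfraredMinimumUncertainty`: the vacuity on hard cores forces a near-minimiser (or form-ground-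
state) IMU as well, and there the sibling disprover of stmt-11784 has typed the admissible shape —
`InfraredMinimumUncertainty.Negative.not_infraredMinimumUncertaintyNearMinimisers` /
`eventually_lt_pi_free_vanishing_slack` (`MinimalityLoadBearing.lean`): with the slack chosen BEFORE
`N` (even `δ_N = 1/L_N → 0`) an INFRARED density wave at the lowest mode makes `Π_{e₀} → ∞` for the
free gas; only a slack `δ(N)` below the first torus gap `(2π/L_N)²` can survive. Together: class-blind
chains must quantify "`∀ᶠ N, ∃ δ > 0, ∀ δ`-near-minimisers" (gap-scale slack, as the route's target
`SmoothPeriodicBEC` does) AND cap every mode-wise floor. -/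

namespace Levers

/-- Verbatim copy of `Cruxes/HardCoreExtension/SketchIdeator3.lean :: Ideator3.QuadraticFloor` (card
`second-moment-floor-class-blind`; the crux-strength stub replacing `PuffFloor` on the full class): the
class-blind quadratic floor for every real non-negative NEAR-minimiser at ALL modes. FALSE as typed
(`not_quadraticFloorNearMin`). [folklore] -/
def QuadraticFloorNearMin : Prop :=
  ∀ v : ℝ → ℝ≥0∞, IsRepulsiveFiniteRange v →
    ∃ C : ℝ, 0 ≤ C ∧ ∃ ρ₀ : ℝ, 0 < ρ₀ ∧ ∀ ρ : ℝ, 0 < ρ → ρ < ρ₀ →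
      ∀ᶠ n : ℕ in atTop, ∃ δ : ℝ≥0∞, 0 < δ ∧
        ∀ Ψ : PeriodicTrialState (n + 1) (sideLength ρ (n + 1)),
          (let L : ℝ := sideLength ρ (n + 1)
           let S : (Fin 3 → ℤ) → ℝ := fun m => ((n : ℝ) + 1)⁻¹ *
             ∫ X in cellN (n + 1) L, ‖∑ j : Fin (n + 1), cellWave L m (X j)‖ ^ 2 * ‖Ψ.ψ X‖ ^ 2
           let kn : (Fin 3 → ℤ) → ℝ := fun m => ‖((2 * Real.pi / L) • latticeVec 1 m)‖
           periodicEnergy v Ψ ≤ periodicGroundStateEnergy v (n + 1) L + δ →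
           periodicEnergy v Ψ ≠ ⊤ →
           (∀ X, Ψ.ψ X = (‖Ψ.ψ X‖ : ℂ)) →
           ∀ m : Fin 3 → ℤ, m ≠ 0 → kn m ^ 2 / (kn m ^ 2 + C * ρ) ≤ S m)

/-- **Typed repair** of `QuadraticFloorNearMin`: the same floor CAPPED at `½` (what the engine
`SecondMomentFloor` — `|k|⁴(1 − S)² ≤ 4 S D/N` — actually yields, and what survives the UV junk of
§10). Crux-strength; consistent at `v = 0` (near-minimisers of the free gas have `S_m ≥ 1 − 3N√(δ/gap)`
uniformly in `m`). [folklore] -/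
def QuadraticFloorCapped : Prop :=
  ∀ v : ℝ → ℝ≥0∞, IsRepulsiveFiniteRange v →
    ∃ C : ℝ, 0 ≤ C ∧ ∃ ρ₀ : ℝ, 0 < ρ₀ ∧ ∀ ρ : ℝ, 0 < ρ → ρ < ρ₀ →
      ∀ᶠ n : ℕ in atTop, ∃ δ : ℝ≥0∞, 0 < δ ∧
        ∀ Ψ : PeriodicTrialState (n + 1) (sideLength ρ (n + 1)),
          (let L : ℝ := sideLength ρ (n + 1)
           let S : (Fin 3 → ℤ) → ℝ := fun m => ((n : ℝ) + 1)⁻¹ *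
             ∫ X in cellN (n + 1) L, ‖∑ j : Fin (n + 1), cellWave L m (X j)‖ ^ 2 * ‖Ψ.ψ X‖ ^ 2
           let kn : (Fin 3 → ℤ) → ℝ := fun m => ‖((2 * Real.pi / L) • latticeVec 1 m)‖
           periodicEnergy v Ψ ≤ periodicGroundStateEnergy v (n + 1) L + δ →
           periodicEnergy v Ψ ≠ ⊤ →
           (∀ X, Ψ.ψ X = (‖Ψ.ψ X‖ : ℂ)) →
           ∀ m : Fin 3 → ℤ, m ≠ 0 → min (1 / 2) (kn m ^ 2 / (kn m ^ 2 + C * ρ)) ≤ S m)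

end Levers

/-- The capped floor is formally weaker than the uncapped one (so the repair loses nothing a proof of
the original could have used downstream, and everything the UV junk attacks). [folklore] -/
theorem quadraticFloorCapped_of_nearMin (h : Levers.QuadraticFloorNearMin) :
    Levers.QuadraticFloorCapped := by
  intro v hv
  obtain ⟨C, hC, ρ₀, hρ₀, h⟩ := h v hv
  refine ⟨C, hC, ρ₀, hρ₀, fun ρ hρ hρ₀' => ?_⟩
  filter_upwards [h ρ hρ hρ₀'] with n hn
  obtain ⟨δ, hδ, hn⟩ := hn
  refine ⟨δ, hδ, fun Ψ => ?_⟩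
  have hΨ := hn Ψ
  dsimp only at hΨ ⊢
  intro h1 h2 h3 m hm
  exact (min_le_right _ _).trans (hΨ h1 h2 h3 m hm)

/-- **`Ideator3.QuadraticFloor` is FALSE as typed** — LANDED (p76160, commit f9ce93a9ecfe) as
`Negative.quadraticFloorNearMin_false` in `Theorems/HardCoreExtension/Negative/QuadraticFloorNearMinFalse.lean`
(imported; the lever there is this `Levers.QuadraticFloorNearMin` verbatim): for the free gas `v ≡ 0`
(admissible, `E₀^per = 0`), any density, every `N = n + 1 ≥ 2` and every slack `δ' > 0`, the
anti-correlated witness with `ε = η/N²` at the mode `m = (j,0,0)`, `j = ⌊√(Cρ/(εn))/(2π/L)⌋ + 1`, has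
energy `≤ 2ε²N³k² ≤ η(8Cρ + 16π²/L²) < δ'` for `η` small, yet `S_m = 1 − εn < k²/(k² + Cρ)` since
`Cρ < k²·εn`. The general principle (ANY floor with `(1 − f(k))·k → 0` dies the same way, at every
side `L`, every `N ≥ 2`, every slack) is `Negative.freeGas_nearMinimiser_floor_violated` with
`deficit_quadratic` / `deficit_sqrt` (`Negative/NearMinimiserFloorUV.lean`, p77692 accepted). [folklore] -/
theorem not_quadraticFloorNearMin : ¬ Levers.QuadraticFloorNearMin :=
  Negative.quadraticFloorNearMin_false


section CappedConsistency

open Summit.AtomisticToContinuum.BoseEinsteinCondensation.Theorems.PuffFloor.Negative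
  (pairCorr continuous_pairCorr integral_cellN_pairCorr measureReal_cellN integrableOn_cellN_real)

variable {N : ℕ} {L : ℝ}

/-! ### §10b Consistency of the capped repair at the free gas (inlined copy of the Negative file `QuadraticFloorCappedFreeGas.lean`, p77636 ACCEPTED 2da440c6bf68; Poincaré gap `π²/L²` of the tree) -/

/-- Young: `‖c‖² ≤ (1+s)‖a‖² + (1+s⁻¹)‖a − c‖²` for `s > 0`. [folklore] -/
theorem norm_sq_le_young (a c : ℂ) {s : ℝ} (hs : 0 < s) :
    ‖c‖ ^ 2 ≤ (1 + s) * ‖a‖ ^ 2 + (1 + s⁻¹) * ‖a - c‖ ^ 2 := by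
  have htri : ‖c‖ ≤ ‖a‖ + ‖a - c‖ := by
    have h := norm_add_le a (c - a)
    rw [add_sub_cancel, norm_sub_rev] at h
    exact h
  have hx : 0 ≤ ‖a‖ := norm_nonneg _
  have hy : 0 ≤ ‖a - c‖ := norm_nonneg _
  have hc : 0 ≤ ‖c‖ := norm_nonneg _
  have h1 : ‖c‖ ^ 2 ≤ (‖a‖ + ‖a - c‖) ^ 2 := pow_le_pow_left₀ hc htri 2
  have h2 : (1 + s) * ‖a‖ ^ 2 + (1 + s⁻¹) * ‖a - c‖ ^ 2 - (‖a‖ + ‖a - c‖) ^ 2 =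
      s⁻¹ * (s * ‖a‖ - ‖a - c‖) ^ 2 := by
    field_simp
    ring
  have h3 : 0 ≤ s⁻¹ * (s * ‖a‖ - ‖a - c‖) ^ 2 := by positivity
  linarith

/-- The Bochner normalisation of a periodic trial state: `∫_{cell^N} ‖Ψ‖² = 1`. [folklore] -/
theorem integral_norm_sq_eq_one' (Ψ : PeriodicTrialState N L) :
    ∫ X in cellN N L, ‖Ψ.ψ X‖ ^ 2 = 1 := by
  have hint : Integrable (fun X => ‖Ψ.ψ X‖ ^ 2) (volume.restrict (cellN N L)) :=
    integrableOn_cellN_real L ((Ψ.contDiff.continuous.norm).pow 2)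
  have h := ofReal_integral_eq_lintegral_ofReal hint
    (Filter.Eventually.of_forall fun X => sq_nonneg _)
  simp_rw [← coe_nnnorm_sq_eq_ofReal] at h
  rw [Ψ.norm_eq] at h
  have hnn : 0 ≤ ∫ X in cellN N L, ‖Ψ.ψ X‖ ^ 2 := integral_nonneg fun X => sq_nonneg _
  have := congrArg ENNReal.toReal h
  rwa [ENNReal.toReal_ofReal hnn, ENNReal.toReal_one] at this

/-- `∫_{cell^N} |ρ̂_m|² = N · L^{3N}` (`m ≠ 0`). [folklore] -/
theorem integral_cellN_normSq_planeWaveSum (hL : 0 < L) {m : Fin 3 → ℤ} (hm : m ≠ 0) :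
    ∫ X in cellN N L, ‖∑ j : Fin N, cellWave L m (X j)‖ ^ 2 = (N : ℝ) * (L ^ 3) ^ N := by
  have hfun : (fun X : Config N => ‖∑ j : Fin N, cellWave L m (X j)‖ ^ 2) =
      fun X => pairCorr L m X + N := by
    funext X; rw [pairCorr, planeWaveSum]; ring
  have hi1 : IntegrableOn (fun X : Config N => pairCorr L m X) (cellN N L) volume :=
    integrableOn_cellN_real L (continuous_pairCorr L m)
  have hi2 : IntegrableOn (fun _ : Config N => (N : ℝ)) (cellN N L) volume :=
    integrableOn_const (by
      rw [volume_cellN]; exact ENNReal.pow_ne_top (ENNReal.pow_ne_top ENNReal.ofReal_ne_top))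
  rw [hfun, integral_add hi1 hi2, integral_cellN_pairCorr hL hm, zero_add, setIntegral_const,
    measureReal_cellN hL, smul_eq_mul, mul_comm]

/-! ### Near-constant states have `S_m ≥ ½` at every mode -/

/-- **Core estimate.** If `∫_{cell^N} ‖Ψ − c‖² ≤ 1/(64N)` for some constant `c`, then
`S_m(Ψ) = N⁻¹∫|ρ̂_m|²|Ψ|² ≥ ½` for every `m ≠ 0`. Proof: pointwise Young twice,
`|Ψ|² ≥ ¾|c|² − 3|Ψ−c|²` and `|Ψ|² ≤ (9/8)|c|² + 9|Ψ−c|²`; integrate against `|ρ̂_m|² ∈ [0, N²]`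
(`∫|ρ̂_m|² = N L^{3N}`) and against `1` (`∫|Ψ|² = 1`). [folklore] -/
theorem structureFactor_ge_half_of_near_const (hL : 0 < L) (hN : 0 < N) (Ψ : PeriodicTrialState N L)
    (c : ℂ) (hχ : ∫ X in cellN N L, ‖Ψ.ψ X - c‖ ^ 2 ≤ 1 / (64 * N)) {m : Fin 3 → ℤ} (hm : m ≠ 0) :
    1 / 2 ≤ (N : ℝ)⁻¹ * ∫ X in cellN N L, ‖∑ j : Fin N, cellWave L m (X j)‖ ^ 2 * ‖Ψ.ψ X‖ ^ 2 := by
  have hN' : (0 : ℝ) < N := by exact_mod_cast hN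
  have hV : (0 : ℝ) < (L ^ 3) ^ N := by positivity
  set V : ℝ := (L ^ 3) ^ N with hVdef
  -- notation
  set ρ2 : Config N → ℝ := fun X => ‖∑ j : Fin N, cellWave L m (X j)‖ ^ 2 with hρ2
  set f : Config N → ℝ := fun X => ‖Ψ.ψ X‖ ^ 2 with hf
  set g : Config N → ℝ := fun X => ‖Ψ.ψ X - c‖ ^ 2 with hg
  have hψc : Continuous Ψ.ψ := Ψ.contDiff.continuous
  have hρ2c : Continuous ρ2 := by
    have h := (contDiff_planeWaveSum (M := N) L m).continuous
    unfold planeWaveSum at h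
    exact h.norm.pow 2
  have hfc : Continuous f := (hψc.norm).pow 2
  have hgc : Continuous g := ((hψc.sub continuous_const).norm).pow 2
  have hρ2nn : ∀ X, 0 ≤ ρ2 X := fun X => by positivity
  have hρ2le : ∀ X, ρ2 X ≤ (N : ℝ) ^ 2 := fun X => by
    have h := norm_planeWaveSum_le (M := N) L m X
    unfold planeWaveSum at h
    have h0 : 0 ≤ ‖∑ j : Fin N, cellWave L m (X j)‖ := norm_nonneg _
    show ‖∑ j : Fin N, cellWave L m (X j)‖ ^ 2 ≤ (N : ℝ) ^ 2
    exact pow_le_pow_left₀ h0 h 2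
  -- integrals we know
  have hIρ : ∫ X in cellN N L, ρ2 X = (N : ℝ) * V := integral_cellN_normSq_planeWaveSum hL hm
  have hIf : ∫ X in cellN N L, f X = 1 := integral_norm_sq_eq_one' Ψ
  set κ : ℝ := ∫ X in cellN N L, g X with hκdef
  have hκ0 : 0 ≤ κ := integral_nonneg fun X => by positivity
  set I : ℝ := ∫ X in cellN N L, ρ2 X * f X with hIdef
  -- integrability
  have iρ : IntegrableOn ρ2 (cellN N L) volume := integrableOn_cellN_real L hρ2c
  have if_ : IntegrableOn f (cellN N L) volume := integrableOn_cellN_real L hfc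
  have ig : IntegrableOn g (cellN N L) volume := integrableOn_cellN_real L hgc
  have iρf : IntegrableOn (fun X => ρ2 X * f X) (cellN N L) volume :=
    integrableOn_cellN_real L (hρ2c.mul hfc)
  have iρg : IntegrableOn (fun X => ρ2 X * g X) (cellN N L) volume :=
    integrableOn_cellN_real L (hρ2c.mul hgc)
  have hVol : (volume : Measure (Config N)).real (cellN N L) = V := measureReal_cellN hL N
  -- (1) lower bound on `I`: pointwise `ρ2·f ≥ ¾‖c‖² ρ2 − 3 N² g`
  have hpt1 : ∀ X, 3 / 4 * ‖c‖ ^ 2 * ρ2 X - 3 * (N : ℝ) ^ 2 * g X ≤ ρ2 X * f X := by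
    intro X
    have hy := norm_sq_le_young (Ψ.ψ X) c (by norm_num : (0 : ℝ) < 1 / 3)
    have hf' : 3 / 4 * ‖c‖ ^ 2 - 3 * g X ≤ f X := by
      simp only [hf, hg]
      norm_num at hy
      linarith
    have h1 : (3 / 4 * ‖c‖ ^ 2 - 3 * g X) * ρ2 X ≤ f X * ρ2 X :=
      mul_le_mul_of_nonneg_right hf' (hρ2nn X)
    have h2 : g X * ρ2 X ≤ g X * (N : ℝ) ^ 2 :=
      mul_le_mul_of_nonneg_left (hρ2le X) (by positivity)
    nlinarith
  have hI : 3 / 4 * ‖c‖ ^ 2 * ((N : ℝ) * V) - 3 * (N : ℝ) ^ 2 * κ ≤ I := by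
    have hlin : ∫ X in cellN N L, (3 / 4 * ‖c‖ ^ 2 * ρ2 X - 3 * (N : ℝ) ^ 2 * g X) =
        3 / 4 * ‖c‖ ^ 2 * ((N : ℝ) * V) - 3 * (N : ℝ) ^ 2 * κ := by
      rw [integral_sub (iρ.const_mul _) (ig.const_mul _), integral_const_mul, integral_const_mul,
        hIρ]
    rw [← hlin]
    exact setIntegral_mono ((iρ.const_mul _).sub (ig.const_mul _)) iρf hpt1
  -- (2) upper bound on `1 = ∫ f`: pointwise `f ≤ (9/8)‖c‖² + 9 g`
  have hpt2 : ∀ X, f X ≤ 9 / 8 * ‖c‖ ^ 2 + 9 * g X := by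
    intro X
    have hy := norm_sq_le_young c (Ψ.ψ X) (by norm_num : (0 : ℝ) < 1 / 8)
    rw [norm_sub_rev] at hy
    simp only [hf, hg]
    norm_num at hy
    linarith
  have h1 : 1 ≤ 9 / 8 * ‖c‖ ^ 2 * V + 9 * κ := by
    have hlin : ∫ X in cellN N L, (9 / 8 * ‖c‖ ^ 2 + 9 * g X) = 9 / 8 * ‖c‖ ^ 2 * V + 9 * κ := by
      have ic : IntegrableOn (fun _ : Config N => 9 / 8 * ‖c‖ ^ 2) (cellN N L) volume :=
        integrableOn_const (by
          rw [volume_cellN]; exact ENNReal.pow_ne_top (ENNReal.pow_ne_top ENNReal.ofReal_ne_top))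
      rw [integral_add ic (ig.const_mul _), setIntegral_const, integral_const_mul, hVol, smul_eq_mul]
      ring
    rw [← hIf, ← hlin]
    refine setIntegral_mono if_ ?_ hpt2
    exact (integrableOn_const (by
      rw [volume_cellN]; exact ENNReal.pow_ne_top (ENNReal.pow_ne_top ENNReal.ofReal_ne_top))).add
      (ig.const_mul _)
  -- (3) algebra: `κ ≤ 1/(64N)` ⇒ `I ≥ N(2/3 − 9/64) ≥ N/2`
  have hκ : κ ≤ 1 / (64 * N) := hχ
  have hκN : (N : ℝ) * κ ≤ 1 / 64 := by
    have := mul_le_mul_of_nonneg_left hκ hN'.le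
    rwa [mul_one_div, mul_comm (64 : ℝ), ← div_div, div_self hN'.ne'] at this
  have hu : 8 / 9 * (1 - 9 * κ) ≤ ‖c‖ ^ 2 * V := by nlinarith
  have hI2 : 2 / 3 * (N : ℝ) * (1 - 9 * κ) - 3 * (N : ℝ) ^ 2 * κ ≤ I := by
    have := mul_le_mul_of_nonneg_left hu (by positivity : (0 : ℝ) ≤ 3 / 4 * N)
    nlinarith
  have hN1 : (1 : ℝ) ≤ N := by exact_mod_cast hN
  have hI3 : (N : ℝ) / 2 ≤ I := by nlinarith
  rw [inv_mul_eq_div, le_div_iff₀ hN']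
  linarith

/-! ### From the kinetic bound to closeness: the Poincaré inequality of the cube -/

/-- **Poincaré step.** If the kinetic energy on the cell is `≤ π²/(64 N L²)` then Ψ is
`L²(cell)`-close to its mean: `∫_{cell^N} ‖Ψ − c‖² ≤ 1/(64N)` with `c = ⨍_{box} Ψ`
(tree: `poincare_boxN`, Neumann gap `π²/L²`; `boxN =ᵐ cellN`). [folklore] -/
theorem exists_near_const_of_kinetic_le (hL : 0 < L) (hN : 0 < N) (Ψ : PeriodicTrialState N L)
    (hT : ∫⁻ X in cellN N L, kineticDensity Ψ.ψ X ≤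
      ENNReal.ofReal (Real.pi ^ 2 / L ^ 2 * (1 / (64 * N)))) :
    ∃ c : ℂ, ∫ X in cellN N L, ‖Ψ.ψ X - c‖ ^ 2 ≤ 1 / (64 * N) := by
  have hN' : (0 : ℝ) < N := by exact_mod_cast hN
  set c : ℂ := ⨍ Y in boxN N L, Ψ.ψ Y with hc
  refine ⟨c, ?_⟩
  have hP := Poincare.poincare_boxN N L hL Ψ.ψ Ψ.contDiff
  rw [setLIntegral_congr (boxN_ae_eq_cellN N L), setLIntegral_congr (boxN_ae_eq_cellN N L)] at hP
  have hgap : 0 < Real.pi ^ 2 / L ^ 2 := by positivity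
  have hA : ∫⁻ X in cellN N L, ((‖Ψ.ψ X - c‖₊ : ℝ≥0∞)) ^ 2 ≤ ENNReal.ofReal (1 / (64 * N)) := by
    have h := hP.trans hT
    rw [ENNReal.ofReal_mul hgap.le] at h
    exact (ENNReal.mul_le_mul_iff_right (ENNReal.ofReal_pos.2 hgap).ne' ENNReal.ofReal_ne_top).1 h
  have hint : Integrable (fun X => ‖Ψ.ψ X - c‖ ^ 2) (volume.restrict (cellN N L)) :=
    integrableOn_cellN_real L (((Ψ.contDiff.continuous.sub continuous_const).norm).pow 2)
  have h := ofReal_integral_eq_lintegral_ofReal hint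
    (Filter.Eventually.of_forall fun X => sq_nonneg _)
  simp_rw [← coe_nnnorm_sq_eq_ofReal] at h
  rw [← h] at hA
  exact (ENNReal.ofReal_le_ofReal_iff (by positivity)).1 hA

/-- For the free gas a `δ`-near-minimiser has kinetic energy `≤ δ` (`E₀^per = 0`, no interaction).
[folklore] -/
theorem kinetic_le_of_nearMinimiser_free (hL : 0 < L) (Ψ : PeriodicTrialState N L) {δ : ℝ≥0∞}
    (hE : periodicEnergy (0 : ℝ → ℝ≥0∞) Ψ ≤ periodicGroundStateEnergy (0 : ℝ → ℝ≥0∞) N L + δ) :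
    ∫⁻ X in cellN N L, kineticDensity Ψ.ψ X ≤ δ := by
  rw [periodicGroundStateEnergy_zero_eq_zero N hL, zero_add, periodicEnergy] at hE
  refine le_trans (le_of_eq (lintegral_congr fun X => ?_)) hE
  rw [periodicInteraction_zeroPotential, zero_mul, add_zero]

/-! ### The capped lever holds at the free gas -/

/-- **Consistency of the repair at `v ≡ 0`.** The capped class-blind floor
`min(½, kn m²/(kn m² + Cρ)) ≤ S m` for near-minimisers (the body of
`Cruxes/HardCoreExtension/Disproof.lean :: Levers.QuadraticFloorCapped`, instantiated at the free gas)
HOLDS: `C = 0`, `ρ₀ = 1`, every `n`, `δ = π²/L² · 1/(64N)`. Contrast: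
`QuadraticFloorNearMinFalse.quadraticFloorNearMin_false` (the uncapped floor fails here at every slack).
[folklore] -/
theorem quadraticFloorCapped_holds_at_freeGas :
    ∃ C : ℝ, 0 ≤ C ∧ ∃ ρ₀ : ℝ, 0 < ρ₀ ∧ ∀ ρ : ℝ, 0 < ρ → ρ < ρ₀ →
      ∀ᶠ n : ℕ in atTop, ∃ δ : ℝ≥0∞, 0 < δ ∧
        ∀ Ψ : PeriodicTrialState (n + 1) (sideLength ρ (n + 1)),
          (let L : ℝ := sideLength ρ (n + 1)
           let S : (Fin 3 → ℤ) → ℝ := fun m => ((n : ℝ) + 1)⁻¹ *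
             ∫ X in cellN (n + 1) L, ‖∑ j : Fin (n + 1), cellWave L m (X j)‖ ^ 2 * ‖Ψ.ψ X‖ ^ 2
           let kn : (Fin 3 → ℤ) → ℝ := fun m => ‖((2 * Real.pi / L) • latticeVec 1 m)‖
           periodicEnergy (0 : ℝ → ℝ≥0∞) Ψ ≤
               periodicGroundStateEnergy (0 : ℝ → ℝ≥0∞) (n + 1) L + δ →
           periodicEnergy (0 : ℝ → ℝ≥0∞) Ψ ≠ ⊤ →
           (∀ X, Ψ.ψ X = (‖Ψ.ψ X‖ : ℂ)) →
           ∀ m : Fin 3 → ℤ, m ≠ 0 → min (1 / 2) (kn m ^ 2 / (kn m ^ 2 + C * ρ)) ≤ S m) := by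
  refine ⟨0, le_rfl, 1, one_pos, fun ρ hρ _ => Filter.Eventually.of_forall fun n => ?_⟩
  have hL : 0 < sideLength ρ (n + 1) := Real.rpow_pos_of_pos (by positivity) _
  set L : ℝ := sideLength ρ (n + 1) with hLdef
  have hNpos : 0 < n + 1 := Nat.succ_pos n
  have hNr : (0 : ℝ) < ((n + 1 : ℕ) : ℝ) := by exact_mod_cast hNpos
  refine ⟨ENNReal.ofReal (Real.pi ^ 2 / L ^ 2 * (1 / (64 * ((n + 1 : ℕ) : ℝ)))),
    ENNReal.ofReal_pos.2 (by positivity), fun Ψ => ?_⟩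
  dsimp only
  intro hE _ _ m hm
  refine (min_le_left _ _).trans ?_
  have hT := kinetic_le_of_nearMinimiser_free hL Ψ hE
  obtain ⟨c, hc⟩ := exists_near_const_of_kinetic_le hL hNpos Ψ hT
  have h := structureFactor_ge_half_of_near_const hL hNpos Ψ c hc hm
  push_cast at h
  exact h

end CappedConsistency


/-! ### §10c (gen 3) Checked vacuity: "finite energy ∧ pointwise non-zero" is unsatisfiable at hard cores

Inlined copy of the Negative file `HardCorePositivityVacuity.lean` (p78090, ACCEPTED 7beae6952c14). The route's
`InfraredMinimumUncertainty` / `PuffFloor` and several levers quantify over states with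
`periodicEnergy v Ψ ≠ ⊤ ∧ ∀ X, Ψ.ψ X ≠ 0`; read VERBATIM at `v = hardCorePotential a` (`N ≥ 2`) these
hypotheses are contradictory (`not_finiteEnergy_and_pos_hardCore`), so widening the class of `v` in
such a statement proves nothing about hard cores (`puffFloorShape_vacuous_at_hardCore`). This is the
cheap, kernel-checked half of the §10 trichotomy's first branch; the expensive half (no exact `C¹`
minimiser at all, by unique continuation) stays on paper. -/

section HardCoreVacuity

open Summit.AtomisticToContinuum.BoseEinsteinCondensation.Theorems.PuffFloor.Negative
  (openBoxN isOpen_openBoxN openBoxN_subset_cellN)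

variable {N : ℕ} {L a : ℝ}

/-- The coincidence configuration at the centre of the cell (every particle at `(L/2, L/2, L/2)`)
lies in the open box. [folklore] -/
theorem centreConfig_mem_openBoxN (hL : 0 < L) :
    (fun _ => (WithLp.toLp 2 (fun _ : Fin 3 => L / 2) : Space) : Config N) ∈ openBoxN N L :=
  fun i a => by
    simp only [Set.mem_Ioo]
    constructor <;> linarith

/-- The pair term `v(|xᵢ − xⱼ|)`, `i < j`, is a lower bound for the interaction. [folklore] -/
theorem le_interaction (v : ℝ → ℝ≥0∞) {i j : Fin N} (hij : i < j) (X : Config N) :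
    v (dist (X i) (X j)) ≤ interaction v X := by
  unfold interaction
  refine le_trans ?_ (Finset.single_le_sum
    (f := fun i' : Fin N => ∑ j' ∈ Finset.univ.filter (fun j' => i' < j'), v (dist (X i') (X j')))
    (fun _ _ => bot_le) (Finset.mem_univ i))
  exact Finset.single_le_sum (f := fun j' : Fin N => v (dist (X i) (X j')))
    (fun _ _ => bot_le) (Finset.mem_filter.2 ⟨Finset.mem_univ j, hij⟩)

/-- Within distance `a` of each other, two hard spheres make the periodic interaction infinite.
[folklore] -/
theorem periodicInteraction_hardCore_eq_top {i j : Fin N} (hij : i < j) {X : Config N}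
    (hX : dist (X i) (X j) < a) (L : ℝ) :
    periodicInteraction (hardCorePotential a) L X = ⊤ := by
  refine eq_top_iff.2 ?_
  calc (⊤ : ℝ≥0∞) = hardCorePotential a (dist (X i) (X j)) := (hardCorePotential_of_lt hX).symm
    _ ≤ interaction (hardCorePotential a) X := le_interaction _ hij X
    _ ≤ periodicInteraction (hardCorePotential a) L X := interaction_le_periodicInteraction _ L X

/-- **A state of the hard-core gas that does not vanish at the coincidence configuration has infinite
energy** (`a > 0`, `N ≥ 2`, `L > 0`). [folklore] -/
theorem periodicEnergy_hardCore_eq_top_of_ne_zero (ha : 0 < a) (hN : 2 ≤ N) (hL : 0 < L)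
    (Ψ : PeriodicTrialState N L)
    (hΨ : Ψ.ψ (fun _ => (WithLp.toLp 2 (fun _ : Fin 3 => L / 2) : Space)) ≠ 0) :
    periodicEnergy (hardCorePotential a) Ψ = ⊤ := by
  set X₀ : Config N := fun _ => (WithLp.toLp 2 (fun _ : Fin 3 => L / 2) : Space) with hX₀
  set i₀ : Fin N := ⟨0, by omega⟩ with hi₀
  set i₁ : Fin N := ⟨1, by omega⟩ with hi₁
  have h01 : i₀ < i₁ := by rw [hi₀, hi₁, Fin.lt_def]; exact Nat.zero_lt_one
  -- the open set where the integrand is `⊤`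
  set U : Set (Config N) :=
    {X | dist (X i₀) (X i₁) < a} ∩ ({X | Ψ.ψ X ≠ 0} ∩ openBoxN N L) with hU
  have hcont : Continuous Ψ.ψ := Ψ.contDiff.continuous
  have hUo : IsOpen U := by
    refine IsOpen.inter ?_ ((isOpen_ne_fun hcont continuous_const).inter (isOpen_openBoxN N L))
    exact isOpen_lt (by fun_prop) continuous_const
  have hX₀U : X₀ ∈ U := by
    refine ⟨?_, hΨ, centreConfig_mem_openBoxN hL⟩
    show dist (X₀ i₀) (X₀ i₁) < a
    rw [show X₀ i₀ = X₀ i₁ from rfl, dist_self]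
    exact ha
  have hUpos : volume U ≠ 0 := (hUo.measure_pos volume ⟨_, hX₀U⟩).ne'
  have hUcell : U ⊆ cellN N L := fun X hX => openBoxN_subset_cellN N L hX.2.2
  -- on `U` the integrand is `⊤`
  have htop : ∀ X ∈ U, (⊤ : ℝ≥0∞) ≤
      kineticDensity Ψ.ψ X + periodicInteraction (hardCorePotential a) L X * ((‖Ψ.ψ X‖₊ : ℝ≥0∞)) ^ 2 := by
    intro X hX
    have h1 : periodicInteraction (hardCorePotential a) L X = ⊤ :=
      periodicInteraction_hardCore_eq_top h01 hX.1 L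
    have h2 : ((‖Ψ.ψ X‖₊ : ℝ≥0∞)) ^ 2 ≠ 0 := by
      have : (‖Ψ.ψ X‖₊ : ℝ≥0∞) ≠ 0 := by
        rw [Ne, ENNReal.coe_eq_zero, nnnorm_eq_zero]; exact hX.2.1
      exact pow_ne_zero 2 this
    rw [h1, ENNReal.top_mul h2]
    exact le_add_self
  -- integrate
  refine eq_top_iff.2 ?_
  calc (⊤ : ℝ≥0∞) = ⊤ * volume U := (ENNReal.top_mul hUpos).symm
    _ = ∫⁻ _ in U, (⊤ : ℝ≥0∞) := (setLIntegral_const U ⊤).symm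
    _ ≤ ∫⁻ X in U, kineticDensity Ψ.ψ X +
          periodicInteraction (hardCorePotential a) L X * ((‖Ψ.ψ X‖₊ : ℝ≥0∞)) ^ 2 :=
        setLIntegral_mono' hUo.measurableSet htop
    _ ≤ periodicEnergy (hardCorePotential a) Ψ := lintegral_mono_set hUcell

/-- **Every finite-energy state of the hard-core gas has a zero** (at the coincidence configuration).
[folklore] -/
theorem exists_eq_zero_of_periodicEnergy_hardCore_ne_top (ha : 0 < a) (hN : 2 ≤ N) (hL : 0 < L)
    (Ψ : PeriodicTrialState N L) (hE : periodicEnergy (hardCorePotential a) Ψ ≠ ⊤) :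
    ∃ X, Ψ.ψ X = 0 := by
  by_contra h
  exact hE (periodicEnergy_hardCore_eq_top_of_ne_zero ha hN hL Ψ fun h0 => h ⟨_, h0⟩)

/-- **"Finite energy and pointwise non-zero" is unsatisfiable for hard cores.** Any class-blind
statement quantifying over such states (the shape of the route's `InfraredMinimumUncertainty` /
`PuffFloor` read at `v = hardCorePotential a`) is vacuous there. [folklore] -/
theorem not_finiteEnergy_and_pos_hardCore (ha : 0 < a) (hN : 2 ≤ N) (hL : 0 < L)
    (Ψ : PeriodicTrialState N L) :
    ¬ (periodicEnergy (hardCorePotential a) Ψ ≠ ⊤ ∧ ∀ X, Ψ.ψ X ≠ 0) := fun h =>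
  h.1 (periodicEnergy_hardCore_eq_top_of_ne_zero ha hN hL Ψ (h.2 _))

/-- **Illustration: the `PuffFloor` body read verbatim at a hard core holds trivially** — for every
`a > 0`, every `C`, every density `ρ > 0`, every `n ≥ 1` and every state, because the hypotheses
"finite energy" and "pointwise non-zero" cannot both hold (minimality, reality and the mode are never
inspected). So extending `PuffFloor`/`IMU` to hard cores by merely widening the class of `v` proves
nothing about hard cores. [folklore] -/
theorem puffFloorShape_vacuous_at_hardCore (ha : 0 < a) (C : ℝ) {ρ : ℝ} (hρ : 0 < ρ) {n : ℕ}
    (hn : 1 ≤ n) (Ψ : PeriodicTrialState (n + 1) (sideLength ρ (n + 1))) :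
    (let L : ℝ := sideLength ρ (n + 1)
     let S : (Fin 3 → ℤ) → ℝ := fun m => ((n : ℝ) + 1)⁻¹ *
       ∫ X in cellN (n + 1) L, ‖∑ j : Fin (n + 1), cellWave L m (X j)‖ ^ 2 * ‖Ψ.ψ X‖ ^ 2
     let kn : (Fin 3 → ℤ) → ℝ := fun m => ‖((2 * Real.pi / L) • latticeVec 1 m)‖
     periodicEnergy (hardCorePotential a) Ψ =
         periodicGroundStateEnergy (hardCorePotential a) (n + 1) L →
       periodicEnergy (hardCorePotential a) Ψ ≠ ⊤ →
       (∀ X, Ψ.ψ X = (‖Ψ.ψ X‖ : ℂ)) → (∀ X, Ψ.ψ X ≠ 0) →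
       ∀ m : Fin 3 → ℤ, m ≠ 0 → kn m / Real.sqrt (kn m ^ 2 + C * ρ) ≤ S m) := by
  dsimp only
  intro _ hfin _ hpos
  have hL : 0 < sideLength ρ (n + 1) := Real.rpow_pos_of_pos (by positivity) _
  exact absurd ⟨hfin, hpos⟩ (not_finiteEnergy_and_pos_hardCore ha (by omega) hL Ψ)

end HardCoreVacuity

/-! ### §10d (gen 3) Checked: `C¹` states of the hard-core gas carry ZERO Cauchy data at contact

Inlined copy of the Negative file `HardCoreContactCauchyData.lean` (p78297, ACCEPTED a409cfc20b30): a finite-energy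
`C¹` periodic state of `v = hardCorePotential a` vanishes WITH ITS DERIVATIVE on the open contact region
and, by continuity along the inward segment `xⱼ ↦ xⱼ + t(xᵢ − xⱼ)`, at every contact configuration
`dist(xᵢ,xⱼ) ≤ a` of the open box (`hardCore_contact_cauchyData`, `kineticDensity_eq_zero_of_contact`).
This is the kernel-checked root of the first branch of the §10 trichotomy: an exact `C¹` minimiser
would be a Dirichlet eigenfunction of the free region with zero Cauchy data at the wall, hence `≡ 0`
by unique continuation (paper) — and the physical ground state's Hopf boundary layer (which carries the
`4πaρN`) is exactly what the `C¹` class cannot represent, only approximate. -/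

section HardCoreContact

open Summit.AtomisticToContinuum.BoseEinsteinCondensation.Theorems.PuffFloor.Negative
  (openBoxN isOpen_openBoxN openBoxN_subset_cellN)

variable {N : ℕ} {L a : ℝ}

/-- **Infinite energy from a non-zero value near contact.** If a periodic trial state of the
hard-core gas (`v = hardCorePotential a`) does not vanish at an open-box configuration `X₀` with
`dist(xᵢ,xⱼ) < a` for some `i < j`, then `periodicEnergy v Ψ = ⊤`. [folklore] -/
theorem periodicEnergy_hardCore_eq_top_of_ne_zero_at (Ψ : PeriodicTrialState N L) {i j : Fin N}
    (hij : i < j) {X₀ : Config N} (hX₀ : X₀ ∈ openBoxN N L) (hclose : dist (X₀ i) (X₀ j) < a)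
    (hΨ : Ψ.ψ X₀ ≠ 0) : periodicEnergy (hardCorePotential a) Ψ = ⊤ := by
  set U : Set (Config N) :=
    {X | dist (X i) (X j) < a} ∩ ({X | Ψ.ψ X ≠ 0} ∩ openBoxN N L) with hU
  have hcont : Continuous Ψ.ψ := Ψ.contDiff.continuous
  have hUo : IsOpen U := by
    refine IsOpen.inter ?_ ((isOpen_ne_fun hcont continuous_const).inter (isOpen_openBoxN N L))
    exact isOpen_lt (by fun_prop) continuous_const
  have hX₀U : X₀ ∈ U := ⟨hclose, hΨ, hX₀⟩
  have hUpos : volume U ≠ 0 := (hUo.measure_pos volume ⟨_, hX₀U⟩).ne'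
  have hUcell : U ⊆ cellN N L := fun X hX => openBoxN_subset_cellN N L hX.2.2
  have htop : ∀ X ∈ U, (⊤ : ℝ≥0∞) ≤
      kineticDensity Ψ.ψ X +
        periodicInteraction (hardCorePotential a) L X * ((‖Ψ.ψ X‖₊ : ℝ≥0∞)) ^ 2 := by
    intro X hX
    have h1 : periodicInteraction (hardCorePotential a) L X = ⊤ := by
      refine eq_top_iff.2 ?_
      calc (⊤ : ℝ≥0∞) = hardCorePotential a (dist (X i) (X j)) := (hardCorePotential_of_lt hX.1).symm
        _ ≤ interaction (hardCorePotential a) X := le_interaction _ hij X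
        _ ≤ periodicInteraction (hardCorePotential a) L X := interaction_le_periodicInteraction _ L X
    have h2 : ((‖Ψ.ψ X‖₊ : ℝ≥0∞)) ^ 2 ≠ 0 := by
      have : (‖Ψ.ψ X‖₊ : ℝ≥0∞) ≠ 0 := by
        rw [Ne, ENNReal.coe_eq_zero, nnnorm_eq_zero]; exact hX.2.1
      exact pow_ne_zero 2 this
    rw [h1, ENNReal.top_mul h2]
    exact le_add_self
  refine eq_top_iff.2 ?_
  calc (⊤ : ℝ≥0∞) = ⊤ * volume U := (ENNReal.top_mul hUpos).symm
    _ = ∫⁻ _ in U, (⊤ : ℝ≥0∞) := (setLIntegral_const U ⊤).symm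
    _ ≤ ∫⁻ X in U, kineticDensity Ψ.ψ X +
          periodicInteraction (hardCorePotential a) L X * ((‖Ψ.ψ X‖₊ : ℝ≥0∞)) ^ 2 :=
        setLIntegral_mono' hUo.measurableSet htop
    _ ≤ periodicEnergy (hardCorePotential a) Ψ := lintegral_mono_set hUcell

/-- **Finite energy ⇒ zero on the open contact region.** [folklore] -/
theorem eq_zero_of_close_pair (Ψ : PeriodicTrialState N L)
    (hE : periodicEnergy (hardCorePotential a) Ψ ≠ ⊤) {i j : Fin N} (hij : i < j) {X : Config N}
    (hX : X ∈ openBoxN N L) (hclose : dist (X i) (X j) < a) : Ψ.ψ X = 0 := by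
  by_contra h
  exact hE (periodicEnergy_hardCore_eq_top_of_ne_zero_at Ψ hij hX hclose h)

/-- **Finite energy ⇒ zero DERIVATIVE on the open contact region** (the state vanishes on an open
neighbourhood). [folklore] -/
theorem fderiv_eq_zero_of_close_pair (Ψ : PeriodicTrialState N L)
    (hE : periodicEnergy (hardCorePotential a) Ψ ≠ ⊤) {i j : Fin N} (hij : i < j) {X : Config N}
    (hX : X ∈ openBoxN N L) (hclose : dist (X i) (X j) < a) : fderiv ℝ Ψ.ψ X = 0 := by
  have hV : ({Y : Config N | dist (Y i) (Y j) < a} ∩ openBoxN N L) ∈ 𝓝 X :=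
    ((isOpen_lt (by fun_prop) continuous_const).inter (isOpen_openBoxN N L)).mem_nhds ⟨hclose, hX⟩
  have hEq : Ψ.ψ =ᶠ[𝓝 X] fun _ => (0 : ℂ) :=
    Filter.eventually_of_mem hV fun Y hY => eq_zero_of_close_pair Ψ hE hij hY.2 hY.1
  rw [hEq.fderiv_eq]
  exact fderiv_const_apply 0

/-- **Zero Cauchy data at contact.** For a finite-energy `C¹` state of the hard-core gas, at every
open-box configuration with a pair at distance `≤ a` (in particular AT contact, `dist = a`) both the
state and its full derivative vanish: along the inward segment `xⱼ ↦ xⱼ + t(xᵢ − xⱼ)`, `t ↓ 0`, the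
configuration stays in the open box with the pair strictly closer than `a`, and `Ψ`, `DΨ` are
continuous. [folklore] -/
theorem hardCore_contact_cauchyData (ha : 0 < a) (Ψ : PeriodicTrialState N L)
    (hE : periodicEnergy (hardCorePotential a) Ψ ≠ ⊤) {i j : Fin N} (hij : i < j) {X : Config N}
    (hX : X ∈ openBoxN N L) (hcontact : dist (X i) (X j) ≤ a) :
    Ψ.ψ X = 0 ∧ fderiv ℝ Ψ.ψ X = 0 := by
  have hne : i ≠ j := hij.ne
  -- the inward segment
  set Y : ℝ → Config N := fun t => Function.update X j (X j + t • (X i - X j)) with hY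
  have hYc : Continuous Y :=
    continuous_const.update j (continuous_const.add (continuous_id.smul continuous_const))
  have hY0 : Y 0 = X := by simp [hY]
  have hYi : ∀ t, Y t i = X i := fun t => by simp [hY, Function.update_of_ne hne]
  have hYj : ∀ t, Y t j = X j + t • (X i - X j) := fun t => by simp [hY]
  have hdist : ∀ t, dist (Y t i) (Y t j) = |1 - t| * dist (X i) (X j) := by
    intro t
    rw [hYi, hYj, dist_eq_norm, dist_eq_norm,
      show X i - (X j + t • (X i - X j)) = (1 - t) • (X i - X j) by
        rw [sub_smul, one_smul]; abel,
      norm_smul, Real.norm_eq_abs]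
  -- for small `t > 0` the segment lies in the open box with the pair strictly closer than `a`
  have hnhds : Y ⁻¹' openBoxN N L ∈ 𝓝 (0 : ℝ) :=
    (isOpen_openBoxN N L).preimage hYc |>.mem_nhds (by rw [Set.mem_preimage, hY0]; exact hX)
  obtain ⟨t₀, ht₀, hball⟩ := Metric.mem_nhds_iff.1 hnhds
  have hin : ∀ t ∈ Set.Ioo (0 : ℝ) (min t₀ 1), Y t ∈ openBoxN N L ∧ dist (Y t i) (Y t j) < a := by
    intro t ht
    have ht0 : 0 < t := ht.1
    have ht1 : t < t₀ := lt_of_lt_of_le ht.2 (min_le_left _ _)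
    have ht2 : t < 1 := lt_of_lt_of_le ht.2 (min_le_right _ _)
    refine ⟨hball ?_, ?_⟩
    · rw [Metric.mem_ball, Real.dist_eq, sub_zero, abs_of_pos ht0]; exact ht1
    · rw [hdist, abs_of_pos (by linarith)]
      have hd0 : 0 ≤ dist (X i) (X j) := dist_nonneg
      calc (1 - t) * dist (X i) (X j) ≤ (1 - t) * a :=
            mul_le_mul_of_nonneg_left hcontact (by linarith)
        _ < a := by nlinarith
  have hm0 : 0 < min t₀ 1 := lt_min ht₀ one_pos
  have h0mem : (0 : ℝ) ∈ closure (Set.Ioo (0 : ℝ) (min t₀ 1)) := by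
    rw [closure_Ioo hm0.ne]; exact ⟨le_rfl, hm0.le⟩
  constructor
  · -- the value
    have hcont : Continuous fun t : ℝ => Ψ.ψ (Y t) := Ψ.contDiff.continuous.comp hYc
    have hEq : Set.EqOn (fun t : ℝ => Ψ.ψ (Y t)) (fun _ => (0 : ℂ)) (Set.Ioo 0 (min t₀ 1)) :=
      fun t ht => eq_zero_of_close_pair Ψ hE hij (hin t ht).1 (hin t ht).2
    have h := hEq.closure hcont continuous_const h0mem
    simpa [hY0] using h
  · -- the derivative
    have hcont : Continuous fun t : ℝ => fderiv ℝ Ψ.ψ (Y t) :=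
      (Ψ.contDiff.continuous_fderiv one_ne_zero).comp hYc
    have hEq : Set.EqOn (fun t : ℝ => fderiv ℝ Ψ.ψ (Y t)) (fun _ => (0 : Config N →L[ℝ] ℂ))
        (Set.Ioo 0 (min t₀ 1)) :=
      fun t ht => fderiv_eq_zero_of_close_pair Ψ hE hij (hin t ht).1 (hin t ht).2
    have h := hEq.closure hcont continuous_const h0mem
    simpa [hY0] using h

/-- In particular the kinetic energy density of a finite-energy state vanishes at every contact
configuration of the open box: in the `C¹` class the hard wall carries no boundary layer. [folklore] -/
theorem kineticDensity_eq_zero_of_contact (ha : 0 < a) (Ψ : PeriodicTrialState N L)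
    (hE : periodicEnergy (hardCorePotential a) Ψ ≠ ⊤) {i j : Fin N} (hij : i < j) {X : Config N}
    (hX : X ∈ openBoxN N L) (hcontact : dist (X i) (X j) ≤ a) : kineticDensity Ψ.ψ X = 0 := by
  have h := (hardCore_contact_cauchyData ha Ψ hE hij hX hcontact).2
  simp [kineticDensity, h]

end HardCoreContact

/-! ## §11 Census, gen 3 (2026-08-16)

NEW THIS GENERATION (all `lean check`ed; landed where marked):
* §10 near-minimiser UV junk — `Ideator3.QuadraticFloor` (class-blind floor for near-minimisers at
  all modes) FALSE as typed (`not_quadraticFloorNearMin`, sorry-free; landed p76160 (accepted) as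
  `Negative/QuadraticFloorNearMinFalse.lean` with the packaged witness
  `Negative.exists_freeState_structureFactor_eq`; general principle `Negative.freeGas_nearMinimiser_floor_violated`
  for ANY floor with `(1 − f(k))k → 0`, p77692 ACCEPTED as `Negative/NearMinimiserFloorUV.lean`); typed repair
  `Levers.QuadraticFloorCapped` with
  `quadraticFloorCapped_of_nearMin`; the trichotomy exact (vacuous on hard cores, unique continuation) /
  near (UV-false) / capped (crux-strength) for every class-blind floor; §8 verdict corrected;
  §10b the capped repair HOLDS at the free gas for near-minimisers
  (`quadraticFloorCapped_holds_at_freeGas`, Poincaré gap; Negative file `QuadraticFloorCappedFreeGas.lean`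
  p77636, accepted) — the `½`-cap is exactly the line between gap-protected dips and free UV dips;
  §10c checked vacuity of `Ψ ≠ 0 ∧ finite energy` at hard cores (p78090); §10d checked zero Cauchy data
  of finite-energy `C¹` states at the hard wall (p78297).

WHY THE CRUX STILL RESISTS (unchanged): `¬crux ↔ A ∧ ¬B` (§1); `A` = thermodynamic-limit dilute BEC
for every smooth repulsive finite-range potential (open; its only computable member `v = 0` is on the
TRUE side, `antecedentAt_zero`); `B` has no junk member (gens 1–3: hard sets, null sets, `⊤` at a
point, open dense thin hard sets `⊤·1_U` — the last acts, for the continuous trial class AND for the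
form closure (ACL along radial lines), as the full hard shell `⊤·1_{Ū}`: no discrepancy to exploit).

ATTACKS ADDED TO THE LEDGER OF FAILURES (gen 3): (i) near-minimiser junk against `B` itself — none:
`B` speaks of `condensateNumber` = `sup_δ inf` over near-minimisers of `maxOccupation`, an
`L²`-Lipschitz functional (`|occ(Ψ) − occ(Ψ')| ≤ N(‖Ψ‖+‖Ψ'‖)‖Ψ−Ψ'‖` uniformly in the mode), so the
UV trick of §10 moves `λ_max` by `O(N√(δ/gap)) = o(N)` only; (ii) exact-minimiser vacuity against `A`
or `B` — none: neither speaks of exact minimisers; (iii) uniformity corners of the would-be uniform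
antecedents (`UniformSmoothPeriodicBEC`, `UniformSmoothClassBEC`): weak-wide members (`𝔞 ≪ R`,
mean-field regime, Bogoliubov `S = k/√(k²+2ρv̂)`) and tall-thin members (`t·φ → ` hard core of radius
`supp φ ≤ a₀`) both stay consistent under the dilute guard `ρ < ρ₀(a₀, R₀)`; hard-shell degeneracy
tuning (§7) needs `ρR³ ≈ 0.4`, excluded by the guard.

OPEN TARGETS carried forward: (T1) antitone comparison with `o(N)` slack (`Sketch.DominationOrderReversal`,
`Sketch.PeelingMonotone`); (T4) `ρ₀` bounded below along fixed-range families; NEW (T5): once a line is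
picked, every stub quantifying over states must be checked against the §10 trichotomy (exact ⇒ vacuous on
hard cores; near + all modes ⇒ UV-false unless the functional is `L²`-Lipschitz uniformly in the mode or
capped).
-/

/-! ## §12 (gen 3) The picked line `third-law-current-floor` read against this file (2026-08-16)

`PICKED.md` (lead, 02:53Z): line `Lines/third-law-current-floor.lean`, 7 stubs S1–S7, composition
`HardCoreExtension_of : ShortDistanceCoherence → BoundaryTransferWeak → HardCoreExtension` kernel-checked; drefute
report `Negative-Survived-third-law-current-floor.md`: 0 stub-false / 0 misstated / 7 survived. The standing
adversary CONCURS, stub by stub, and records what each of its landed lemmas forbids a prover to do: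

* S1 `stub_secondMomentFloor` (exact identity + Cauchy–Schwarz, reality hypothesis): TRUE (re-derived §8);
  nothing here bites. (Reality is load-bearing — drefute §S1.m; their lane.)
* S2 `stub_forceStructureBound`, S3 `stub_uniformLevyBound`: quantified over EXACT positive minimisers of BOUNDED
  `v` (range `≤ R`, `∀ᶠ n` BEFORE `∀ v`). This is the only admissible shape by the §10 trichotomy: for bounded `v`
  exact `C¹` minimisers exist (S6) and are unique up to phase, so `Ψ = ‖Ψ‖ ≠ 0` is redundant-but-harmless; at
  hard cores the same text would be VACUOUS (`not_finiteEnergy_and_pos_hardCore`, §10c, p78090;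
  `hardCore_contact_cauchyData`, §10d, p78297) — and the line indeed never instantiates S2/S3 at a hard core
  (hard cores enter only through S7). What the landed negatives forbid: weakening "exact" to "near with a slack
  chosen before `n`" (IMU sibling `MinimalityLoadBearing`: false already at slack `1/L²`; drefute §S2.m: CFB false
  at every fixed intensive slack), or to "near, all modes, any slack" for a FLOOR (`NearMinimiserFloorUV`,
  p77692). Crux-strength residue = S2 (new) + S3 (= 11784 uniform): agreed.
* S4 `stub_uniformChainGlue`: its hypothesis (1) is the CAPPED quadratic floor `min(½, |k|²/(16Cρ)) ≤ S_m`
  (`uniformQuadraticFloor`, proved in the skeleton from S1+S2) — exactly the repair `Levers.QuadraticFloorCapped`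
  of §10 (`quadraticFloorCapped_of_nearMin`, `quadraticFloorCapped_holds_at_freeGas`, §10b, p77636 accepted); the
  uncapped near-minimiser floor `Ideator3.QuadraticFloor` that the merged card carried is FALSE
  (`not_quadraticFloorNearMin`, p76160) and is NOT used by the line. ✓.
* S5 `stub_diluteClustering` (Cauchy form, `∀ v ∃ ρ₁`, `∀ᶠ N` then `∀ η ∃ δ`): the guard §7 demands, in the
  order §6 demands (a `∃ρ₁ ∀v` form would be the all-density statement by dilation and is false through packed
  hard cores, `condensateNumber_hardCorePotential_eq_zero`-style; not asserted). TRUE on paper (sector gap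
  `≥ 2π²/R²` vs `O(ρR)`, connectivity of the dilute hard-set configuration space, positivity improving); the
  tuned degenerate shell of §7 lives at `ρR³ ≈ 0.4`, outside `ρ < ρ₁(v)`. Free gas: Poincaré (§10b machinery)
  gives it with `δ = O(η/(N L²))`.
* S6 `stub_boundedPositiveMinimiser`: known in print; boundedness NECESSARY beyond hard cores (drefute: Kato cusp
  for `r⁻¹`-type singularities ⇒ no `C¹` minimiser) — consistent with §10d (zero Cauchy data is the hard-core
  extreme of the same phenomenon).
* S7 `stub_truncationTransfer` = `Levers.MonotoneLimitTransferSimple` (§7's repair) in Cauchy form along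
  `min(v,n) ↑ v`: carries the clustering hypothesis whose absence §7 refutes (`not_monotoneLimitTransfer`,
  paper). Its one feared obstruction — a `⊤`-set for which the `C¹` infimum EXCEEDS the form bottom
  `sup_n E₀(min(v,n))` — is ABSENT for radial pair profiles, and the adversary endorses drefute's argument with one
  sharpening: the `C¹` infimum equals `λ₁` over `H¹₀(U)` EXACTLY (`U` = complement of the forced-vanishing set `Z`:
  finite-energy `C¹` states are continuous `H¹` functions vanishing on `Z`, hence in `H¹₀(U)` for ARBITRARY open
  `U`; conversely symmetrised `C_c^∞(U)` lies in the class), while the form bottom is `λ₁` over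
  `{ψ ∈ H¹ : ψ = 0 a.e. on Z}`; for `Z = {X : dist(xᵢ,xⱼ) ∈ K some i<j}` with `K` the essential closure of the
  non-`L¹_loc` radii, the two spaces COINCIDE: along a.e. radial ray `ψ(·,ω)` is absolutely continuous, vanishes
  a.e. on `K` hence on `K` (zeros accumulate at every point of an essentially closed set), its derivative vanishes
  at a.e. point of `K`, and the Lipschitz cut-offs `χ_n(r) = min(1, n·dist(r,K))` give `ψχ_n → ψ` in `H¹`
  (`∫_{layer} n²|ψ|² ≤ ∫ (window of width 2/n around K) |∂_rψ|² → ∫_{K} |∂_rψ|² = 0`), with `ψχ_n` vanishing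
  near `Z` — so `ψ ∈ H¹₀(U)`. No spectral-synthesis pathology (Keldysh-unstable domains need capacity-thin
  complements, impossible for unions of full spheres over an essentially closed set of radii).

NET: the line honours every landed negative of gens 1–3; its open content is S2 + S3, both of BEC calibre and both
Bogoliubov-consistent with margin; the adversary has no cheap attack left on the line as typed. Targets for the next
re-arm: the lead's STUCK stubs (none yet), and any prover-side weakening of S2/S3/S7 of the three forbidden kinds
listed above. -/


/-! ## §13 (gen 4) The common geometric sub-crux of both surviving lines: dilute hard-sphere connectivity (2026-08-16)

STATE OF PLAY at this re-arm: PICKED line `third-law-current-floor` (S1–S7; lead cycles 0, S1 re-registered with a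
proof ready); REGISTERED skeleton (03:15Z, planner g2) `Lines/near-minimiser-slack-transfer.lean` with stubs
T `stub_uniformSmoothPeriodicBEC` (crux-strength, = route target 11783 with `(ρ₀,c,N₀)` uniform over the smooth
class of range `≤ R`), F `stub_slackUniformisation` (one slack for the whole class at fixed `N`), A
`stub_energyApproximation` (every admissible `v` is reached IN ENERGY by smooth-class `w` at fixed `(N,L,ε)`);
composition `HardCoreExtension_of h0827 = fun _ v hv => h0827 v hv (periodicBEC_of T F A v hv)` — the crux's
antecedent is idle (as it must be, §1), the line proves `PeriodicBEC` for every admissible `v`.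

(A) JUNK READ-BACK of T/F/A (all instances checked on paper; none bites): `N ≤ 1` (no pairs: (a),(b) of A and the
`c·N ≤ n₀` clauses trivial/true); `ε = ⊤`, `δ = ⊤` (A trivial; in F's HYPOTHESIS `δ = ⊤` would assert `n₀ ≥ cN`
for ALL states — false for `c > 0`, `N ≥ 1` (plane waves have `n₀ = 0`), so the hypothesis provider takes `δ` small; harmless); `c > 1` (F vacuously
true: `n₀ ≤ N`, tree `condensateOccupation_le_card`); `c ≤ 0` (trivial); packed boxes (`E₀^per = ⊤`) are EXCLUDED
in A by hypothesis and in T/F by the density guards — load-bearing: `finiteness_false_without_dilute_guard` below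
(hard spheres above `8/b³`, tree `eventually_periodicGroundStateEnergy_hardCorePotential_eq_top`); a.e.-junk
potentials (`⊤` or `1` on `[0,1] ∖ ℚ`, on a fat Cantor set): A asks for energy APPROXIMANTS, not minorants, and
`periodicEnergy` sees only the a.e.-class of `v ∘ |·|` (tree `PeriodicIRBound.Negative.periodicEnergy_congr_ae`),
so the v1-card caveat (no continuous minorant of `1_K`, `K` nowhere dense) refutes nothing here — and the picked
line never smooths at all (S2–S6 are typed for BOUNDED measurable `v`, S7 truncates); A at HARD SETS with interior
(hard core `⊤·1_{[0,a)}`): clause (a) is EXACT for every `w` supported in `[0,a)` (finite-energy states vanish on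
the contact set, §10c/§10d), so A there is just inner continuity `E₀^per(HC_{a−η}) ↑ E₀^per(HC_a)` plus monotone
convergence `t·φ ↑` (paper: zero trace from the exterior of a Lipschitz contact set, Keldysh stability); A at fat
Cantor hard shells needs the card's `η²T` layer estimate (Poincaré on gaps narrower than `2η`) — fine on paper.
T at `v = 0`: tree `KineticGapLengthScalesFreeGas.free_gas_gapWindow_condensation` / `periodicBEC_antecedent_free`
(`c = ½`, slack `N/(2CL²)`); F's mechanism at `v → 0` or `v` shrinking to a point: near-minimisers become free
near-minimisers, Poincaré (§10b). UNIFORMITY CORNERS of T/F (tall `t·φ →` hard core/shell; weak-wide; two-scale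
cores) all stay consistent under `ρ < ρ₀(R) ≍ R⁻³`: a trapped-pair sector of a shell `[a,b] ⊂ (0,R]` costs
`2π²/a² − (2μ_N − μ_dimer) ≥ 2π²/R² − 16πRρ > 0` for `ρR³ < π/8 ≈ 0.39` UNIFORMLY in `N` (this is the §7 number),
and repulsive range-`≤ R` pair problems have no two-body structure below energy `O(1/R²)` (no bound states, no
threshold resonances for `v ≥ 0`), so at fixed dilute `(N, L_N)` the low-lying spectrum over the class is governed
by `𝔞 ∈ [0,R]` — F is "as safe as BEC", not refutable here.

(B) THE FINDING. Both fixed-volume simplicity stubs quantify, at the crux's own potential `v = hardCorePotential b`,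
over ALL LARGE `N` at small fixed `ρb³`:
* S5 `stub_diluteClustering` (picked line; sized "L, truth not in doubt" in PICKED.md): clustering of all
  `δ`-near-minimisers modulo phase ⟺ (compact resolvent on `𝕋³`, C¹-infimum = form bottom by §12) the bottom of the
  bosonic Dirichlet spectrum of the free region `U_N = {all image pair distances > b}` is SIMPLE. On each connected
  component Perron–Frobenius gives simplicity, so S5(HC_b) ⟸ `LemmaGConnected` (below: `S_N` acts transitively on
  `π₀(U_N)`, eventually in `N`, for `ρ < ρ₁(b)`) — and conversely S5(HC_b) FAILS exactly when two components NOT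
  related by a permutation have tied bottoms for infinitely many `N`.
* F `stub_slackUniformisation`: its Γ-compactness proof names the same limit objects; but F SURVIVES a tie between
  components `G₁, G₂` related by a point symmetry `σ` of the torus PROVIDED the `n₀` cross term
  `X = N∫ PΨ₁·conj(PΨ₂) dY` vanishes (radial `v_k` have `σ`-symmetric positive ground states → `(Ψ₁+Ψ₂)/√2`, and
  `n₀` is `σ`-invariant, so with `X = 0`: `n₀(αΨ₁+βΨ₂) = |α|²n₁+|β|²n₂ = n₁ = n₀((Ψ₁+Ψ₂)/√2)` and the contradiction
  closes). `X` lives on the `(N−1)`-configurations `Y` completable into BOTH components by adding one sphere — i.e.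
  `Y` whose one-sphere free space is disconnected with pockets leading to different GLOBAL components; for components
  differing by global structure (not by the position of one sphere) this set should be empty or of tiny measure, but
  that is itself a statement about `π₀(U_N)`. With `X ≠ 0`, or under an accidental tie with `n₁ ≠ n₂`, F needs the
  poorly-selected combination to be condensed too — BEC-strength. S5 (clustering) fails under ANY tie. So the picked
  line carries the MORE fragile formulation, and F the more robust one, but neither is tie-proof.
* WHICH TIES ARE POSSIBLE. A component in which some cluster is geometrically confined (a caged sphere, a trapped
  pair) has bottom energy above the gas component by the inhomogeneity cost (`ρ ↦ ρ·e(ρ) = 4π𝔞ρ²` convex; a cluster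
  of `M` spheres kept at diameter `≲ √M b` has density `≫ ρ`): margin `≳ 𝔞/b³ ≍ 1/b²` minus `O(Mμ)`, positive at small
  `ρb³` — no tie, uniformly in `N` (the §7 tie needs `ρR³ ≈ 0.4`). What no argument in print excludes is a SPLITTING
  OF THE UNCONFINED REGION ITSELF into several components (then mirror-image components tie exactly). Naive peeling
  ("some sphere has all contacts in a closed half-space, move it") is NOT available configuration by configuration:
  sparse locally-jammed packings exist (Böröczky 1964, density → 0 in the plane; Kahle 2012 in a square), so any
  proof must use collective motions.
* RIGOUR OF THE SECTOR GAP (the second, milder hidden lemma of S5/F — resolved on paper here). LOWER side, three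
  lines: on the trapped sector (pair `{1,2}` at relative distance `< a`, Dirichlet at `|x₁−x₂| = a`) drop the pair's
  centre-of-mass kinetic energy, bound the relative one fibrewise by the Dirichlet ball value `2π²/a²` (operator
  `−2Δ_r`), and bound `Σ_{j≥3}T_j` fibrewise by `E_gas(N−2)` (for fixed `x₁,x₂` the fibre is an admissible symmetric
  `(N−2)`-sphere function; extra exclusions only raise energies): `E_trap(N) ≥ E_gas(N−2) + 2π²/a²`. UPPER side = a
  ONE-PARTICLE INSERTION BOUND for the true torus ground state, `E_gas(N+1) ≤ E_gas(N) + Cρ^{2/3}` uniformly in `N` at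
  `ρb³ ≤ c₀`: NOT a consequence of the energy asymptotics in print (LY1998/LSSY2005 carry extensive `o(N)` errors),
  but provable in one page — trial state `f(x)χ(X)Ψ_N(X)` with `χ = Π_j(1 − η_H(x_j))` emptying a ball `H = B(p,R_H)`,
  `R_H = 0.3ρ^{-1/3}`, and `f` the Dirichlet ground state of `B(p, R_H − b)` for the new centre; (i) averaging the
  hole centre `p` over the torus gives `⟨#{j : x_j ∈ H}⟩_Ψ = ρ|H| ≤ 0.12` for SOME `p`, whatever the (possibly
  degenerate) ground state, so `‖χΨ_N‖² ≥ ½`; (ii) IMS localisation for the EIGENFUNCTION `Ψ_N`: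
  `⟨χΨ_N, H_N χΨ_N⟩ = E(N)‖χΨ_N‖² + ⟨Ψ_N, |∇χ|²Ψ_N⟩` — no multiplicative loss on the extensive `E(N)` (the naive
  product/Jastrow insertion spread over the torus loses a factor `1+O(φ)` on `E(N)`, an extensive error: that is why
  this bound is not "free"); (iii) `⟨Ψ_N,|∇χ|²Ψ_N⟩ ≤ ρ∫|∇η_H|² = O(ρR_H)` and `‖∇f‖²/‖f‖² = π²/(R_H−b)² = O(ρ^{2/3})`.
  Hence `E_gas(N) ≤ E_gas(N−2) + 2Cρ^{2/3} < E_trap(N)` once `2Cρ^{2/3} < 2π²/a²`, i.e. under the dilute guard,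
  UNIFORMLY IN `N`: trapped-pair sectors of hard shells are gapped away rigorously-on-paper, and the same fibre
  argument prices any component carrying a HARD confinement. What it cannot price is a component of the unconfined
  region itself — Lemma G.
* STATUS IN PRINT: connectivity of hard-sphere configuration spaces in the thermodynamic regime is OPEN —
  Baryshnikov–Bubenik–Kahle, "Min-type Morse theory for configuration spaces of hard spheres", IMRN 2014
  (doi:10.1093/imrn/rnt012, arXiv:1108.3061) §6: "What is the threshold radius r = r(n) for connectivity of
  Conf(n,r)? … Diaconis, Lebeau, and Michel noted that r ≤ c/n is sufficient … It would be interesting to know if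
  connectivity of the configuration space ever extends into the thermodynamic limit, i.e. are there any bounding
  regions so that Conf(n,r) is connected for r ≤ Cn^{−1/d}"; their Thm 5.1 (no critical values of the tautological
  function below `r < L/2n`) is the `r ≤ c/n` regime, useless at fixed density. Simányi, "Proof of the ergodic
  hypothesis for typical hard ball systems", AHP 5 (2004) (doi:10.1007/s00023-004-0166-8, arXiv:math/0210280),
  p. 2 and (2.1.1): "We always assume that the radius r > 0 is not too big, so that even the interior of the arising
  configuration space Q is connected" — assumed, with no density threshold. (Both read this session, pages quoted
  from the materialised texts.)
* THIS CORRECTS the drefute report `Negative-Survived-third-law-current-floor.md` §S5 ("the all-free region … is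
  connected when dilute", S5 "TRUE on paper") and the gen-3 concurrence of §12: S5 is not stub-false (no counterexample
  is known or expected) but stub-OPEN-INSIDE; evidence note `stub-open: stub_diluteClustering — LemmaG` filed on the item.
* CONSEQUENCE FOR THE LEAD / PLANNERS (the adversary files no reshaping; this is the briefing): S5 at hard cores =
  `LemmaGConnected ∨ (no cross-component ties)`, an open problem in discrete geometry hidden in an "L" stub; either
  (i) name it — a sub-stub `LemmaGConnected` (typed below, importable) feeding S5 via Perron–Frobenius + Rellich, so
  the audit shows where the open geometry sits; or (ii) weaken S5 to what S7 consumes under ties with vanishing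
  cross terms (an `n₀`-level clustering: `|n₀(Φ) − n₀(Φ')| ≤ ηN` for `δ`-near-minimisers — true under symmetric
  ties, still false under an accidental tie with `n₁ ≠ n₂`), or to F's slack form. For SMOOTH / `L¹_loc` potentials
  S5 is unconditionally fine (connected configuration space, positivity improving); the issue is exactly the hard
  wall the crux exists for.

(C) CHECKED HERE: `LemmaGConnected` (typed); `finiteness_false_without_dilute_guard` (S5's/F's/T's density guard
is load-bearing: above `8/b³` the first conjunct of S5 fails for hard spheres, eventually in `N`); and the free-gas
instance of S5, `diluteClustering_holds_at_freeGas` — near-minimisers of the free periodic gas cluster modulo a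
phase at the gap scale (`δ = π²t²/L²`, `t = min(1, η/33)`), via the parametric Poincaré step
`exists_near_const_of_kinetic_le'`, the two-sided mass bounds `mass_bounds_of_near_const` and the phase alignment
`norm_sub_argPhase_mul`. -/

section LemmaG

/-- The (open) free region of `N` hard spheres with exclusion distance `b` on the torus of side `L`: every
pair, in every lattice image, strictly farther than `b` (the interior of `{periodicInteraction (hardCorePotential b) L ≠ ⊤}`).
[folklore] -/
def hardSphereFreeRegion (N : ℕ) (L b : ℝ) : Set (Config N) :=
  {X | ∀ i j : Fin N, i ≠ j → ∀ n : Fin 3 → ℤ, b < ‖X i - X j - latticeVec L n‖}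

/-- **LEMMA G (connectivity, thermodynamic regime).** For every exclusion distance `b > 0` there is a density
`ρ₁ > 0` such that for `0 < ρ < ρ₁` and all large `N`, on the torus of side `L_N = (N/ρ)^{1/3}`, any two free
configurations are joined INSIDE the free region up to a relabelling of the spheres (the symmetric group acts
transitively on the path components). This is what `stub_diluteClustering` at `v = hardCorePotential b` rests on
(Perron–Frobenius per component); OPEN (Baryshnikov–Bubenik–Kahle 2014 §6; assumed as (2.1.1) by Simányi 2004).
[cite: doi:10.1093/imrn/rnt012 §6; doi:10.1007/s00023-004-0166-8 (2.1.1)] -/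
def LemmaGConnected : Prop :=
  ∀ b : ℝ, 0 < b → ∃ ρ₁ : ℝ, 0 < ρ₁ ∧ ∀ ρ : ℝ, 0 < ρ → ρ < ρ₁ → ∀ᶠ N : ℕ in atTop,
    ∀ X ∈ hardSphereFreeRegion N (sideLength ρ N) b, ∀ Y ∈ hardSphereFreeRegion N (sideLength ρ N) b,
      ∃ σ : Equiv.Perm (Fin N), JoinedIn (hardSphereFreeRegion N (sideLength ρ N) b) X (Y ∘ σ)

/-- Pigeonhole in the cell `[0,L)³`: if `N > ⌈2L/a⌉³`, two particles are at distance `< a` (copy of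
`LatticeToPeriodicBridge.Negative.exists_dist_lt_of_ceil_pow_lt_of_mem_cellN`, inlined to keep this workfile
independent of other routes' Theses modules). [folklore] -/
private theorem exists_dist_lt_cellN_aux {N : ℕ} {L a : ℝ} (ha : 0 < a) (hN : ⌈2 * L / a⌉₊ ^ 3 < N)
    {X : Config N} (hX : X ∈ cellN N L) : ∃ i j : Fin N, i ≠ j ∧ dist (X i) (X j) < a := by
  set m : ℕ := ⌈2 * L / a⌉₊ with hm
  have hcell : ∀ (i : Fin N) (k : Fin 3), ⌊2 * X i k / a⌋₊ < m := by
    intro i k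
    have hx : X i k ∈ Set.Ico 0 L := hX i k
    rw [Nat.floor_lt (by have := hx.1; positivity)]
    calc 2 * X i k / a < 2 * L / a := by
          exact div_lt_div_of_pos_right (by linarith [hx.2]) ha
      _ ≤ m := Nat.le_ceil _
  let c : Fin N → Fin 3 → Fin m := fun i k => ⟨⌊2 * X i k / a⌋₊, hcell i k⟩
  have hcard : Fintype.card (Fin 3 → Fin m) < Fintype.card (Fin N) := by
    simpa [Fintype.card_fun, Fintype.card_fin] using hN
  obtain ⟨i, j, hij, hc⟩ := Fintype.exists_ne_map_eq_of_card_lt c hcard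
  refine ⟨i, j, hij, ?_⟩
  have hcoord : ∀ k : Fin 3, dist (X i k) (X j k) < a / 2 := by
    intro k
    have hk : ⌊2 * X i k / a⌋₊ = ⌊2 * X j k / a⌋₊ := by
      have := congr_fun hc k
      simpa [c, Fin.ext_iff] using this
    have hxi : X i k ∈ Set.Ico 0 L := hX i k
    have hxj : X j k ∈ Set.Ico 0 L := hX j k
    have hpi : 0 ≤ 2 * X i k / a := by have := hxi.1; positivity
    have hpj : 0 ≤ 2 * X j k / a := by have := hxj.1; positivity
    have h1 := Nat.floor_le hpi
    have h2 := Nat.lt_floor_add_one (2 * X i k / a)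
    have h3 := Nat.floor_le hpj
    have h4 := Nat.lt_floor_add_one (2 * X j k / a)
    rw [hk] at h1 h2
    have hlt : |2 * X i k / a - 2 * X j k / a| < 1 := by
      rw [abs_sub_lt_iff]; constructor <;> linarith
    rw [Real.dist_eq]
    have hrew : X i k - X j k = (a / 2) * (2 * X i k / a - 2 * X j k / a) := by
      field_simp
    rw [hrew, abs_mul, abs_of_pos (by positivity : (0 : ℝ) < a / 2)]
    calc a / 2 * |2 * X i k / a - 2 * X j k / a| < a / 2 * 1 :=
          mul_lt_mul_of_pos_left hlt (by positivity)
      _ = a / 2 := mul_one _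
  rw [EuclideanSpace.dist_eq, Real.sqrt_lt' ha]
  calc ∑ k, dist (X i k) (X j k) ^ 2 < ∑ _k : Fin 3, (a / 2) ^ 2 :=
        Finset.sum_lt_sum_of_nonempty Finset.univ_nonempty fun k _ =>
          pow_lt_pow_left₀ (hcoord k) dist_nonneg two_ne_zero
    _ = 3 * (a / 2) ^ 2 := by simp
    _ < a ^ 2 := by nlinarith

/-- Packed torus ⇒ every periodic trial state has infinite hard-core energy; hence `E₀^per = ⊤` eventually along
`L_N` above `8/a³` (copies of `LatticeToPeriodicBridge.Negative.periodicEnergy_hardCorePotential_eq_top` /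
`eventually_periodicGroundStateEnergy_hardCorePotential_eq_top`). [folklore] -/
private theorem eventually_E0per_top_aux {a : ℝ} (ha : 0 < a) {ρ : ℝ} (hρ : 8 / a ^ 3 < ρ) :
    ∀ᶠ N : ℕ in atTop, periodicGroundStateEnergy (hardCorePotential a) N (sideLength ρ N) = ⊤ := by
  filter_upwards [eventually_ceil_sideLength_pow_lt ha hρ] with N hN
  rw [periodicGroundStateEnergy, iInf_eq_top]
  intro Ψ
  have hpt : ∀ X ∈ cellN N (sideLength ρ N), ⊤ * ((‖Ψ.ψ X‖₊ : ℝ≥0∞) ^ 2) ≤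
      kineticDensity Ψ.ψ X +
        periodicInteraction (hardCorePotential a) (sideLength ρ N) X * (‖Ψ.ψ X‖₊ : ℝ≥0∞) ^ 2 := by
    intro X hX
    obtain ⟨i, j, hij, hd⟩ := exists_dist_lt_cellN_aux ha hN hX
    have htop : periodicInteraction (hardCorePotential a) (sideLength ρ N) X = ⊤ := by
      refine eq_top_iff.2 ?_
      calc (⊤ : ℝ≥0∞) = interaction (hardCorePotential a) X :=
            (interaction_eq_top_of_apply_eq_top hij (hardCorePotential_of_lt hd)).symm
        _ ≤ periodicInteraction (hardCorePotential a) (sideLength ρ N) X :=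
            interaction_le_periodicInteraction _ _ X
    rw [htop]
    exact le_add_self
  have h1 : ∫⁻ X in cellN N (sideLength ρ N), ⊤ * ((‖Ψ.ψ X‖₊ : ℝ≥0∞) ^ 2) = ⊤ := by
    rw [lintegral_const_mul _ (measurable_ennnormSq Ψ.contDiff.continuous), Ψ.norm_eq, mul_one]
  rw [periodicEnergy, eq_top_iff, ← h1]
  exact setLIntegral_mono' (measurableSet_cellN N _) hpt

/-- **The density guard of S5 / F / T is load-bearing** (S5's first conjunct WITHOUT `ρ < ρ₁(v)` is false): for
hard spheres of radius `1` at density `9 > 8`, the periodic ground-state energy on `L_N = (N/9)^{1/3}` is `⊤` for all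
large `N` (pigeonhole in the cell, tree `eventually_periodicGroundStateEnergy_hardCorePotential_eq_top`), so
"`∀ v ∀ ρ > 0 ∀ᶠ N, E₀^per ≠ ⊤`" fails — and with `E₀^per = ⊤` every state is a near-minimiser, so the clustering
clause fails there too (paper: the constant state vs. a zero-mean symmetrised plane wave are at `L²`-distance `√2`
modulo every phase). [folklore] -/
theorem finiteness_false_without_dilute_guard :
    ¬ ∀ v : ℝ → ℝ≥0∞, IsRepulsiveFiniteRange v → ∀ ρ : ℝ, 0 < ρ → ∀ᶠ N : ℕ in atTop,
        periodicGroundStateEnergy v N (sideLength ρ N) ≠ ⊤ := by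
  intro h
  have h1 := h (hardCorePotential 1) (isRepulsiveFiniteRange_hardCorePotential 1) 9 (by norm_num)
  have h2 := eventually_E0per_top_aux (a := 1) one_pos (ρ := 9) (by norm_num)
  obtain ⟨N, hN1, hN2⟩ := (h1.and h2).exists
  exact hN1 hN2

end LemmaG

section FreeClustering

open Summit.AtomisticToContinuum.BoseEinsteinCondensation.Theorems.PuffFloor.Negative
  (measureReal_cellN integrableOn_cellN_real)

variable {N : ℕ} {L : ℝ}

/-- **Parametric Poincaré step** (cf. `exists_near_const_of_kinetic_le`, §10b): kinetic energy on the cell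
`≤ (π²/L²)·κ` puts `Ψ` within `κ` of its mean in `L²(cell^N)`. [folklore] -/
theorem exists_near_const_of_kinetic_le' (hL : 0 < L) (Ψ : PeriodicTrialState N L) {κ : ℝ} (hκ : 0 ≤ κ)
    (hT : ∫⁻ X in cellN N L, kineticDensity Ψ.ψ X ≤ ENNReal.ofReal (Real.pi ^ 2 / L ^ 2 * κ)) :
    ∃ c : ℂ, ∫ X in cellN N L, ‖Ψ.ψ X - c‖ ^ 2 ≤ κ := by
  set c : ℂ := ⨍ Y in boxN N L, Ψ.ψ Y with hc
  refine ⟨c, ?_⟩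
  have hP := Poincare.poincare_boxN N L hL Ψ.ψ Ψ.contDiff
  rw [setLIntegral_congr (boxN_ae_eq_cellN N L), setLIntegral_congr (boxN_ae_eq_cellN N L)] at hP
  have hgap : 0 < Real.pi ^ 2 / L ^ 2 := by positivity
  have hA : ∫⁻ X in cellN N L, ((‖Ψ.ψ X - c‖₊ : ℝ≥0∞)) ^ 2 ≤ ENNReal.ofReal κ := by
    have h := hP.trans hT
    rw [ENNReal.ofReal_mul hgap.le] at h
    exact (ENNReal.mul_le_mul_iff_right (ENNReal.ofReal_pos.2 hgap).ne' ENNReal.ofReal_ne_top).1 h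
  have hint : Integrable (fun X => ‖Ψ.ψ X - c‖ ^ 2) (volume.restrict (cellN N L)) :=
    integrableOn_cellN_real L (((Ψ.contDiff.continuous.sub continuous_const).norm).pow 2)
  have h := ofReal_integral_eq_lintegral_ofReal hint
    (Filter.Eventually.of_forall fun X => sq_nonneg _)
  simp_rw [← coe_nnnorm_sq_eq_ofReal] at h
  rw [← h] at hA
  exact (ENNReal.ofReal_le_ofReal_iff hκ).1 hA

/-- **Two-sided mass bounds for a near-constant state**: if `∫_{cell^N}‖Ψ − c‖² ≤ κ` (`Ψ` normalised) then for
every `s > 0`, `1 ≤ (1+s)·|c|²V + (1+s⁻¹)κ` and `|c|²V ≤ (1+s) + (1+s⁻¹)κ`, `V = L^{3N}` (pointwise Young both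
ways, integrated). [folklore] -/
theorem mass_bounds_of_near_const (hL : 0 < L) (Ψ : PeriodicTrialState N L) (c : ℂ) {κ s : ℝ}
    (hs : 0 < s) (hχ : ∫ X in cellN N L, ‖Ψ.ψ X - c‖ ^ 2 ≤ κ) :
    1 ≤ (1 + s) * (‖c‖ ^ 2 * (L ^ 3) ^ N) + (1 + s⁻¹) * κ ∧
      ‖c‖ ^ 2 * (L ^ 3) ^ N ≤ (1 + s) + (1 + s⁻¹) * κ := by
  set V : ℝ := (L ^ 3) ^ N with hVdef
  set f : Config N → ℝ := fun X => ‖Ψ.ψ X‖ ^ 2 with hf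
  set g : Config N → ℝ := fun X => ‖Ψ.ψ X - c‖ ^ 2 with hg
  have hψc : Continuous Ψ.ψ := Ψ.contDiff.continuous
  have hfc : Continuous f := (hψc.norm).pow 2
  have hgc : Continuous g := ((hψc.sub continuous_const).norm).pow 2
  have hIf : ∫ X in cellN N L, f X = 1 := integral_norm_sq_eq_one' Ψ
  have if_ : IntegrableOn f (cellN N L) volume := integrableOn_cellN_real L hfc
  have ig : IntegrableOn g (cellN N L) volume := integrableOn_cellN_real L hgc
  have hVol : (volume : Measure (Config N)).real (cellN N L) = V := measureReal_cellN hL N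
  have hfin : volume (cellN N L) ≠ ⊤ := by
    rw [volume_cellN]; exact ENNReal.pow_ne_top (ENNReal.pow_ne_top ENNReal.ofReal_ne_top)
  set κ' : ℝ := ∫ X in cellN N L, g X with hκ'def
  have hκ' : κ' ≤ κ := hχ
  have hs1 : 0 ≤ 1 + s⁻¹ := by positivity
  have hs2 : 0 ≤ 1 + s := by positivity
  constructor
  · have hpt : ∀ X, f X ≤ (1 + s) * ‖c‖ ^ 2 + (1 + s⁻¹) * g X := fun X => by
      have hy := norm_sq_le_young c (Ψ.ψ X) hs
      rw [norm_sub_rev] at hy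
      exact hy
    have ic : IntegrableOn (fun _ : Config N => (1 + s) * ‖c‖ ^ 2) (cellN N L) volume :=
      integrableOn_const hfin
    have hlin : ∫ X in cellN N L, ((1 + s) * ‖c‖ ^ 2 + (1 + s⁻¹) * g X) =
        (1 + s) * (‖c‖ ^ 2 * V) + (1 + s⁻¹) * κ' := by
      rw [integral_add ic (ig.const_mul _), setIntegral_const, integral_const_mul, hVol, smul_eq_mul]
      ring
    calc (1 : ℝ) = ∫ X in cellN N L, f X := hIf.symm
      _ ≤ ∫ X in cellN N L, ((1 + s) * ‖c‖ ^ 2 + (1 + s⁻¹) * g X) :=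
          setIntegral_mono if_ (ic.add (ig.const_mul _)) hpt
      _ = (1 + s) * (‖c‖ ^ 2 * V) + (1 + s⁻¹) * κ' := hlin
      _ ≤ (1 + s) * (‖c‖ ^ 2 * V) + (1 + s⁻¹) * κ := by gcongr
  · have hpt : ∀ X, ‖c‖ ^ 2 ≤ (1 + s) * f X + (1 + s⁻¹) * g X := fun X =>
      norm_sq_le_young (Ψ.ψ X) c hs
    have hlin : ∫ X in cellN N L, ((1 + s) * f X + (1 + s⁻¹) * g X) = (1 + s) + (1 + s⁻¹) * κ' := by
      rw [integral_add (if_.const_mul _) (ig.const_mul _), integral_const_mul, integral_const_mul, hIf]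
      ring
    have hconst : ∫ X in cellN N L, ‖c‖ ^ 2 = ‖c‖ ^ 2 * V := by
      rw [setIntegral_const, hVol, smul_eq_mul]; ring
    calc ‖c‖ ^ 2 * V = ∫ X in cellN N L, ‖c‖ ^ 2 := hconst.symm
      _ ≤ ∫ X in cellN N L, ((1 + s) * f X + (1 + s⁻¹) * g X) :=
          setIntegral_mono (integrableOn_const hfin) ((if_.const_mul _).add (ig.const_mul _)) hpt
      _ = (1 + s) + (1 + s⁻¹) * κ' := hlin
      _ ≤ (1 + s) + (1 + s⁻¹) * κ := by gcongr

/-- **Phase alignment**: rotating `c'` by `arg c − arg c'` leaves the distance `| |c| − |c'| |` to `c`. [folklore] -/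
theorem norm_sub_argPhase_mul (c c' : ℂ) :
    ‖c - Complex.exp (((Complex.arg c - Complex.arg c' : ℝ) : ℂ) * Complex.I) * c'‖ = |‖c‖ - ‖c'‖| := by
  have hc : (‖c‖ : ℂ) * Complex.exp (Complex.arg c * Complex.I) = c := Complex.norm_mul_exp_arg_mul_I c
  have hc' : (‖c'‖ : ℂ) * Complex.exp (Complex.arg c' * Complex.I) = c' := Complex.norm_mul_exp_arg_mul_I c'
  have hsplit : ((Complex.arg c - Complex.arg c' : ℝ) : ℂ) * Complex.I =
      Complex.arg c * Complex.I + -(Complex.arg c' * Complex.I) := by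
    push_cast; ring
  have key' : Complex.exp (((Complex.arg c - Complex.arg c' : ℝ) : ℂ) * Complex.I) *
      ((‖c'‖ : ℂ) * Complex.exp (Complex.arg c' * Complex.I)) =
      (‖c'‖ : ℂ) * Complex.exp (Complex.arg c * Complex.I) := by
    rw [hsplit, Complex.exp_add, Complex.exp_neg]
    have hne : Complex.exp (Complex.arg c' * Complex.I) ≠ 0 := Complex.exp_ne_zero _
    field_simp
  have key : Complex.exp (((Complex.arg c - Complex.arg c' : ℝ) : ℂ) * Complex.I) * c' =
      (‖c'‖ : ℂ) * Complex.exp (Complex.arg c * Complex.I) := by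
    rw [hc'] at key'
    exact key'
  have hpolar : c - (‖c'‖ : ℂ) * Complex.exp (Complex.arg c * Complex.I) =
      ((‖c‖ : ℂ) - (‖c'‖ : ℂ)) * Complex.exp (Complex.arg c * Complex.I) := by
    rw [sub_mul, hc]
  rw [key, hpolar, norm_mul, Complex.norm_exp_ofReal_mul_I, mul_one, ← Complex.ofReal_sub,
    Complex.norm_real, Real.norm_eq_abs]

/-- `‖x + y + z‖² ≤ 3(‖x‖² + ‖y‖² + ‖z‖²)`. [folklore] -/
theorem norm_add_three_sq_le (x y z : ℂ) :
    ‖x + y + z‖ ^ 2 ≤ 3 * (‖x‖ ^ 2 + ‖y‖ ^ 2 + ‖z‖ ^ 2) := by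
  have h : ‖x + y + z‖ ≤ ‖x‖ + ‖y‖ + ‖z‖ := norm_add₃_le
  have h0 : 0 ≤ ‖x + y + z‖ := norm_nonneg _
  have h1 : ‖x + y + z‖ ^ 2 ≤ (‖x‖ + ‖y‖ + ‖z‖) ^ 2 := pow_le_pow_left₀ h0 h 2
  nlinarith [sq_nonneg (‖x‖ - ‖y‖), sq_nonneg (‖y‖ - ‖z‖), sq_nonneg (‖x‖ - ‖z‖)]

/-- **Near-constant states cluster modulo a phase.** If two periodic trial states are each within `t²` of a
constant in `L²(cell^N)` (`0 < t ≤ 1`), then after a phase rotation they are within `33t` of each other: the two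
constants have moduli with `|c|²V, |c'|²V ∈ [1 − 6t, (1+t)²]`, hence `V(|c|−|c'|)² ≤ 9t`. [folklore] -/
theorem nearConst_cluster (hL : 0 < L) (Φ Φ' : PeriodicTrialState N L) (c c' : ℂ) {t : ℝ}
    (ht : 0 < t) (ht1 : t ≤ 1)
    (hΦ : ∫ X in cellN N L, ‖Φ.ψ X - c‖ ^ 2 ≤ t ^ 2)
    (hΦ' : ∫ X in cellN N L, ‖Φ'.ψ X - c'‖ ^ 2 ≤ t ^ 2) :
    ∃ θ : ℝ, ∫ X in cellN N L, ‖Φ.ψ X - Complex.exp (θ * Complex.I) * Φ'.ψ X‖ ^ 2 ≤ 33 * t := by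
  set V : ℝ := (L ^ 3) ^ N with hVdef
  have hV : 0 < V := by positivity
  obtain ⟨h1, h2⟩ := mass_bounds_of_near_const hL Φ c ht hΦ
  obtain ⟨h1', h2'⟩ := mass_bounds_of_near_const hL Φ' c' ht hΦ'
  have hst : (1 + t⁻¹) * t ^ 2 = t + t ^ 2 := by field_simp; ring
  rw [hst] at h1 h2 h1' h2'
  set u : ℝ := ‖c‖ ^ 2 * V with hu
  set u' : ℝ := ‖c'‖ ^ 2 * V with hu'
  have hu0 : 0 ≤ u := by positivity
  have hu0' : 0 ≤ u' := by positivity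
  -- `u, u' ∈ [1 - 6t, 1 + 2t + t²]`, so `|u - u'| ≤ 9t`
  have htt : t ^ 2 ≤ t := by nlinarith
  have httt : t * t ^ 2 ≤ t * t := mul_le_mul_of_nonneg_left htt ht.le
  have hlow : 1 - 6 * t ≤ u := by nlinarith [mul_le_mul_of_nonneg_left h2 ht.le]
  have hlow' : 1 - 6 * t ≤ u' := by nlinarith [mul_le_mul_of_nonneg_left h2' ht.le]
  have hdiff : |u - u'| ≤ 9 * t := by
    rw [abs_le]
    constructor <;> nlinarith
  -- `V (|c| - |c'|)² ≤ |u - u'|`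
  have hcc : (‖c‖ - ‖c'‖) ^ 2 * V ≤ |u - u'| := by
    have ha : 0 ≤ ‖c‖ := norm_nonneg _
    have hb : 0 ≤ ‖c'‖ := norm_nonneg _
    have hfac : u - u' = ((‖c‖ - ‖c'‖) * V) * (‖c‖ + ‖c'‖) := by rw [hu, hu']; ring
    rw [hfac, abs_mul, abs_mul, abs_of_pos hV]
    have hle : |‖c‖ - ‖c'‖| ≤ |‖c‖ + ‖c'‖| := by
      rw [abs_of_nonneg (by positivity : (0 : ℝ) ≤ ‖c‖ + ‖c'‖), abs_le]
      constructor <;> linarith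
    calc (‖c‖ - ‖c'‖) ^ 2 * V = |‖c‖ - ‖c'‖| * V * |‖c‖ - ‖c'‖| := by rw [← sq_abs]; ring
      _ ≤ |‖c‖ - ‖c'‖| * V * |‖c‖ + ‖c'‖| := by gcongr
  -- the phase
  set θ : ℝ := Complex.arg c - Complex.arg c' with hθ
  refine ⟨θ, ?_⟩
  have hmid : ‖c - Complex.exp ((θ : ℂ) * Complex.I) * c'‖ = |‖c‖ - ‖c'‖| := norm_sub_argPhase_mul c c'
  have hpt : ∀ X, ‖Φ.ψ X - Complex.exp ((θ : ℂ) * Complex.I) * Φ'.ψ X‖ ^ 2 ≤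
      3 * (‖Φ.ψ X - c‖ ^ 2 + (‖c‖ - ‖c'‖) ^ 2 + ‖Φ'.ψ X - c'‖ ^ 2) := by
    intro X
    have hsplit : Φ.ψ X - Complex.exp ((θ : ℂ) * Complex.I) * Φ'.ψ X =
        (Φ.ψ X - c) + (c - Complex.exp ((θ : ℂ) * Complex.I) * c') +
          Complex.exp ((θ : ℂ) * Complex.I) * (c' - Φ'.ψ X) := by ring
    rw [hsplit]
    refine (norm_add_three_sq_le _ _ _).trans (le_of_eq ?_)
    rw [hmid, sq_abs, norm_mul, Complex.norm_exp_ofReal_mul_I, one_mul, norm_sub_rev c' (Φ'.ψ X)]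
  -- integrate
  have hΦc : Continuous Φ.ψ := Φ.contDiff.continuous
  have hΦ'c : Continuous Φ'.ψ := Φ'.contDiff.continuous
  have i1 : IntegrableOn (fun X => ‖Φ.ψ X - c‖ ^ 2) (cellN N L) volume :=
    integrableOn_cellN_real L (((hΦc.sub continuous_const).norm).pow 2)
  have i3 : IntegrableOn (fun X => ‖Φ'.ψ X - c'‖ ^ 2) (cellN N L) volume :=
    integrableOn_cellN_real L (((hΦ'c.sub continuous_const).norm).pow 2)
  have hfin : volume (cellN N L) ≠ ⊤ := by
    rw [volume_cellN]; exact ENNReal.pow_ne_top (ENNReal.pow_ne_top ENNReal.ofReal_ne_top)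
  have i2 : IntegrableOn (fun _ : Config N => (‖c‖ - ‖c'‖) ^ 2) (cellN N L) volume := integrableOn_const hfin
  have iL : IntegrableOn (fun X => ‖Φ.ψ X - Complex.exp ((θ : ℂ) * Complex.I) * Φ'.ψ X‖ ^ 2) (cellN N L) volume :=
    integrableOn_cellN_real L (((hΦc.sub (continuous_const.mul hΦ'c)).norm).pow 2)
  have hVol : (volume : Measure (Config N)).real (cellN N L) = V := measureReal_cellN hL N
  have i12 : IntegrableOn (fun X => ‖Φ.ψ X - c‖ ^ 2 + (‖c‖ - ‖c'‖) ^ 2) (cellN N L) volume := i1.add i2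
  have i123 : IntegrableOn (fun X => ‖Φ.ψ X - c‖ ^ 2 + (‖c‖ - ‖c'‖) ^ 2 + ‖Φ'.ψ X - c'‖ ^ 2)
      (cellN N L) volume := i12.add i3
  have hlin : ∫ X in cellN N L, 3 * (‖Φ.ψ X - c‖ ^ 2 + (‖c‖ - ‖c'‖) ^ 2 + ‖Φ'.ψ X - c'‖ ^ 2) =
      3 * ((∫ X in cellN N L, ‖Φ.ψ X - c‖ ^ 2) + (‖c‖ - ‖c'‖) ^ 2 * V +
        ∫ X in cellN N L, ‖Φ'.ψ X - c'‖ ^ 2) := by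
    rw [integral_const_mul, integral_add i12 i3, integral_add i1 i2, setIntegral_const, hVol,
      smul_eq_mul]
    ring
  calc ∫ X in cellN N L, ‖Φ.ψ X - Complex.exp ((θ : ℂ) * Complex.I) * Φ'.ψ X‖ ^ 2
      ≤ ∫ X in cellN N L, 3 * (‖Φ.ψ X - c‖ ^ 2 + (‖c‖ - ‖c'‖) ^ 2 + ‖Φ'.ψ X - c'‖ ^ 2) :=
        setIntegral_mono iL (i123.const_mul 3) hpt
    _ = 3 * ((∫ X in cellN N L, ‖Φ.ψ X - c‖ ^ 2) + (‖c‖ - ‖c'‖) ^ 2 * V +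
          ∫ X in cellN N L, ‖Φ'.ψ X - c'‖ ^ 2) := hlin
    _ ≤ 3 * (t ^ 2 + 9 * t + t ^ 2) := by
        have hm : (‖c‖ - ‖c'‖) ^ 2 * V ≤ 9 * t := hcc.trans hdiff
        gcongr
    _ ≤ 33 * t := by nlinarith

/-- **S5 `stub_diluteClustering` HOLDS AT THE FREE GAS** (the `v = 0` instance of the picked line's simplicity stub,
and the mechanism of F at `v → 0`): at every density, for every `N ≥ 1`, `E₀^per(0) = 0 ≠ ⊤`, and for `η > 0` the
slack `δ = π²t²/L²`, `t = min(1, η/33)`, makes any two `δ`-near-minimisers of the free periodic energy `η`-close in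
`L²(cell^N)` modulo a phase (Poincaré gap of the cell + `nearConst_cluster`). The configuration space of the free
gas is trivially connected; the content of §13 is that at `v = hardCorePotential b` the same statement rests on
`LemmaGConnected`. [folklore] -/
theorem diluteClustering_holds_at_freeGas :
    ∃ ρ₁ : ℝ, 0 < ρ₁ ∧ ∀ ρ : ℝ, 0 < ρ → ρ < ρ₁ → ∀ᶠ N : ℕ in atTop,
      periodicGroundStateEnergy (0 : ℝ → ℝ≥0∞) N (sideLength ρ N) ≠ ⊤ ∧
      ∀ η : ℝ, 0 < η → ∃ δ : ℝ≥0∞, 0 < δ ∧ ∀ Φ Φ' : PeriodicTrialState N (sideLength ρ N),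
        periodicEnergy (0 : ℝ → ℝ≥0∞) Φ ≤
            periodicGroundStateEnergy (0 : ℝ → ℝ≥0∞) N (sideLength ρ N) + δ →
        periodicEnergy (0 : ℝ → ℝ≥0∞) Φ' ≤
            periodicGroundStateEnergy (0 : ℝ → ℝ≥0∞) N (sideLength ρ N) + δ →
        ∃ θ : ℝ, ∫ X in cellN N (sideLength ρ N),
          ‖Φ.ψ X - Complex.exp (θ * Complex.I) * Φ'.ψ X‖ ^ 2 ≤ η := by
  refine ⟨1, one_pos, fun ρ hρ _ => ?_⟩
  filter_upwards [eventually_gt_atTop 0] with N hN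
  have hL : 0 < sideLength ρ N := sideLength_pos_of_pos hρ hN
  refine ⟨by rw [periodicGroundStateEnergy_zero_eq_zero N hL]; exact ENNReal.zero_ne_top, fun η hη => ?_⟩
  set t : ℝ := min 1 (η / 33) with htdef
  have ht : 0 < t := lt_min one_pos (by positivity)
  have ht1 : t ≤ 1 := min_le_left _ _
  have ht33 : 33 * t ≤ η := by
    have := min_le_right 1 (η / 33)
    rw [← htdef] at this
    linarith
  refine ⟨ENNReal.ofReal (Real.pi ^ 2 / sideLength ρ N ^ 2 * t ^ 2),
    ENNReal.ofReal_pos.2 (by positivity), fun Φ Φ' hΦ hΦ' => ?_⟩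
  obtain ⟨c, hc⟩ := exists_near_const_of_kinetic_le' hL Φ (sq_nonneg t)
    (kinetic_le_of_nearMinimiser_free hL Φ hΦ)
  obtain ⟨c', hc'⟩ := exists_near_const_of_kinetic_le' hL Φ' (sq_nonneg t)
    (kinetic_le_of_nearMinimiser_free hL Φ' hΦ')
  obtain ⟨θ, hθ⟩ := nearConst_cluster hL Φ Φ' c c' ht ht1 hc hc'
  exact ⟨θ, hθ.trans ht33⟩

end FreeClustering

/-! ## §14 Census, gen 4 (2026-08-16)

NEW THIS GENERATION (all `lean check`ed; landed where marked):
* §13 the registered skeleton `near-minimiser-slack-transfer` (T/F/A) junk-audited (all pass) and both fixed-volume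
  simplicity stubs (S5 picked / F registered) traced, at `v = hardCorePotential b`, to `LemmaGConnected` (typed) —
  connectivity mod `S_N` of the dilute hard-sphere configuration space for all large `N`: OPEN (BBK IMRN 2014 §6;
  Simányi AHP 2004 (2.1.1) assumes it); tie dichotomy (S5 false under any cross-component tie; F survives a
  symmetric tie iff the one-sphere `n₀` cross term vanishes); confined-component ties priced on paper (fibrewise lower bound `E_trap ≥ E_gas(N−2) + 2π²/a²`; IMS
  one-particle insertion bound `E(N+1) ≤ E(N) + Cρ^{2/3}`); evidence note `stub-open: stub_diluteClustering — LemmaG`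
  filed (corrects drefute §S5); CHECKED `finiteness_false_without_dilute_guard`, `diluteClustering_holds_at_freeGas`
  (S5 at `v = 0`) — Negative file `FreeGasClustering.lean` (proposal id in NOTES / the item's served_by list).

WHY THE CRUX STILL RESISTS (unchanged): `¬crux ↔ A ∧ ¬B`; `A` open, `B` junk-free (gens 1–4).

OPEN TARGETS carried forward: (T1) antitone comparison with `o(N)` slack; (T4) `ρ₀` bounded below along fixed-range
families (= T's shape); (T5) trichotomy check of every new stub; NEW (T6) `LemmaGConnected` — watch for a proof or a
counterexample (a counterexample = two unconfined components of `U_N` for infinitely many `N` at small `ρb³`; sparse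
locally-jammed packings à la Böröczky are NOT counterexamples — they are not isolated); (T7) the insertion bound
`E^per(N+1) ≤ E^per(N) + Cρ^{2/3}` is a prover-side helper both lines could use (IMS via the weak Euler–Lagrange
equation of an exact minimiser, hole by translation averaging) — positive, hence not this seat's to land; (T8) if a
lead weakens S5 to `n₀`-clustering or adopts F's one-slack form, re-audit against the accidental-tie scenario
(`n₁ ≠ n₂`).
-/

end Summit.AtomisticToContinuum.BoseEinsteinCondensation.Cruxes.HardCoreExtension.Disproof
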